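import Summits.QuantumFields.YangMills.Theorems.LuscherReductionTwistedTraceScalingFlowJunction
import Mathlib.Analysis.SpecificLimits.Basic
import HarnessLib

/-!
# Crux-ideate #1 (gen 4) — FORMAL TELESCOPING: the two-loop tax of `TwistedTraceScaling` paid by a VALUE-FREE step expansion of ONE
# observable plus the log-GROWTH of its two formal coefficients (typed support for card `intrinsic-gap-clock` rev 2, crux stmt-QuantumFields-20203)

HONEST FRAMING. Typing + elementary real analysis in support of a crux IDEA for `LuscherReduction.TwistedTraceScaling` (TTS), a stub-level
child of the CONDITIONAL reduction route `LuscherReduction` (femto rung R2b1); not a mass gap, not Clay; registry untouched; everything here is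
`--supports stmt-QuantumFields-20203 --as helper` material.  No Yang–Mills object is constructed: `G` (a finite-volume coupling), `v₂`, `w` (its
formal one-loop and connected two-loop coefficients) are PARAMETERS, and the four hypotheses below are OPEN for every concrete `G`.

THE MECHANISM (card `Cruxes/TwistedTraceScaling/Ideas/intrinsic-gap-clock.md` rev 2).  Gen 3 (`SketchIdeator1g3`, `tts_of_physicalClock`) split TTS
at a CONCRETE clock `G` into tax-free universality (TOWER-X, BASE) and the tax `CalX G : G(β,L)·(1/ḡ²_label)(β,L) → 1` deep in the window.  This file
proves that `CalX G` follows from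

* `StepExpansion G v₂ w M` — ONE coarsening step `L/M → L` at the SAME bare coupling: `G(β,L) = T₃(G(β,L/M)) + O(G⁴)` UNIFORMLY in `L`, where
  `T₃(u) = u + s₁u² + (t + s₁²)u³` carries the EXACT finite-`L` formal coefficients `s₁ = v₂(L) − v₂(L/M)`, `t = w(L) − w(L/M)` of `G` itself
  (value-free: no number is asserted; by uniqueness of the fixed-lattice `β → ∞` asymptotics the coefficient functions are READ OFF `G`);
* `OneLoopLogGrowth v₂` : `sup_L |v₂(L) − 2b₀ log L| < ∞` and `TwoLoopLogGrowth w` : `sup_L |w(L) − 2b₁ log L| < ∞` — the ONLY place the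
  values `b₀, b₁` enter: as log-growth rates of two explicit finite-dimensional lattice sums (formal lattice perturbation theory, Reisz power
  counting; in print numerically for the SF coupling: `m₁ = 2b₀ ln L + 0.202`, `m₂ − m₁² = 2b₁ ln L + 0.016` [Wolff1994, p.5]);
* `BaseBounded G` : at each FIXED lattice size `1/G(β,b) = β/2 + O_b(1)` (`β → ∞` Laplace on a fixed finite-dimensional manifold).

The proof is EXACT TELESCOPING: along the tower `L_0 < L_1 < ⋯ < L_k = L`, `L_i = ⌊L_{i+1}/M⌋`, the one- and two-loop step coefficients are
differences, so every intermediate `v₂(L_i)`, `w(L_i)` cancels identically in the modified variable `z_i = 1/G(β,L_i) + δ(L_i) + ζ(L_i)·G(β,L_i)`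
(`δ = v₂ − 2b₀ log`, `ζ = w − 2b₁ log`), whose flow is the tree's constant-coefficient two-loop flow of LEAD twolattice
(`TwoLattice.TowerFlow.flowJunction`, `inv_sq_sum_le`, `ratio_near_one_of_abs_sub_le_log` — REUSED, not re-proved) with an absolutely summable
remainder; no rate of convergence, no limit `c₂`, `c₃`, and no monotonicity of the flow is needed.

CONTENTS. §0 statements · §1 the one-step inversion `u ↦ 1/u` with explicit constants · §2 the `z`-flow step · §3 tower arithmetic ·
§4 the remainder bootstrap · §5 ★ `calX_of_formalTelescoping : StepExpansion G v₂ w M → OneLoopLogGrowth v₂ → TwoLoopLogGrowth w → BaseBounded G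
→ CalX G` (`CalX` is VERBATIM the gen-3 statement `Ideas.PhysicalClock.CalX`, restated here because crux workfiles are not importable modules;
the two agree by `Iff.rfl`, so `tts_of_physicalClock` consumes the conclusion BY NAME) · §6 complements: `baseTree_of_baseBounded`
(gen-3's `BaseTree G` follows from `BaseBounded G`, so the assembled line needs no separate `BaseTree`), and the ONE-LOOP toy clock
`oneLoopClock β L = (β/2 − 2b₀ log L)⁻¹`, which inhabits `StepExpansion ∧ OneLoopLogGrowth ∧ BaseBounded` (non-vacuity) while `TwoLoopLogGrowth 0`
FAILS (`not_twoLoopLogGrowth_zero`) — the theorem does not calibrate the one-loop clock, exactly as Disproof §F demands.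

WHICH CLOCKS QUALIFY (card rev 2): the hypotheses presuppose REGULAR (integer-power) fixed-lattice asymptotics of `G` through third order; on the
periodic torus this excludes femto-SPECTRAL clocks (zero modes ⇒ expansions in `ḡ^{2/3}` [cite: Luscher1983Torus, §3]) and selects EFFECTIVE zero-mode
couplings (RG running coupling; background-field observables), for which gen-3's `TowerX`/`BaseRegular` read as a uniform Lüscher effective-Hamiltonian theorem.

Sources: [cite: Wolff1994, p.5] [cite: LuscherWeiszWolff1991, §2] [cite: Rivasseau1991, Lemma II.5.4] [cite: LuscherMunster1984, §2];
Weisz, Les Houches 2009 (arXiv:1004.3462) p.12 (Reisz's lattice power counting), p.14 (universality of `b₀, b₁`), p.23 (lattice step scaling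
function `Σ(u, a/L)`); Reisz, CMP 117 (1988) 639.  Mathlib + tree only; 0 sorry.
-/

set_option autoImplicit false

noncomputable section

open Real
open scoped BigOperators

namespace Summit.QuantumFields.YangMills.Cruxes.TwistedTraceScaling.Ideas.FormalTelescoping

open Summit.QuantumFields.YangMills.Theorems.FemtoTransferGap
open Summit.QuantumFields.YangMills.Theorems.FemtoTransferGap.TwoLattice

/-! ## §0 Statements -/

/-- CAL-X, VERBATIM the gen-3 statement `Cruxes/TwistedTraceScaling/SketchIdeator1g3.lean :: Ideas.PhysicalClock.CalX` (the two-loop tax at a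
concrete clock `G`): `G(β,L)·(1/ḡ²_label)(β,L) → 1` deep in the femto window. [cite: Wolff1994, p.5] -/
def CalX (G : ℝ → ℕ → ℝ) : Prop :=
  ∀ η : ℝ, 0 < η → ∃ lam0 : ℝ, 0 < lam0 ∧ ∀ lam : ℝ, 0 < lam → lam ≤ lam0 →
    ∃ L0 : ℕ, ∀ (L : ℕ) [NeZero L], L0 ≤ L → ∀ β : ℝ, InFemtoWindow lam β L →
      |G β L * invRunningCoupling β L - 1| ≤ η

/-- Formal ONE-loop step coefficient of the pair `(L/M, L)`: `s₁ = v₂(L) − v₂(L/M)`. [cite: LuscherWeiszWolff1991, §2] -/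
def stepOne (v₂ : ℕ → ℝ) (M L : ℕ) : ℝ := v₂ L - v₂ (L / M)

/-- Formal connected TWO-loop step coefficient of the pair `(L/M, L)`: `t = w(L) − w(L/M)`, `w = v₃ − v₂²`. [cite: LuscherWeiszWolff1991, §2] -/
def stepTwo (w : ℕ → ℝ) (M L : ℕ) : ℝ := w L - w (L / M)

/-- The third-order step polynomial `T₃(u) = u + s₁u² + (t + s₁²)u³` of the pair `(L/M, L)` (the lattice step scaling function of `G` to two
loops, with its EXACT finite-`L` coefficients). [cite: LuscherWeiszWolff1991, §2] -/
def stepPoly (v₂ w : ℕ → ℝ) (M L : ℕ) (u : ℝ) : ℝ :=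
  u + stepOne v₂ M L * u ^ 2 + (stepTwo w M L + stepOne v₂ M L ^ 2) * u ^ 3

/-- (R-STEP) **Value-free step expansion** of the observable `G` under ONE coarsening `L/M → L` at the same bare coupling, to third order, with a
remainder `O(G⁴)` UNIFORM in `L`: `|G(β,L) − T₃(G(β,L/M))| ≤ C·G(β,L/M)⁴` whenever `0 < G(β,L/M) ≤ u⋆`, `L ≥ L₀`.  OPEN for every concrete `G`
(asymptoticity of renormalised lattice perturbation theory for one observable under one scale step; constructive, XL). [cite: Balaban1989LargeFieldII, p.355] -/
def StepExpansion (G : ℝ → ℕ → ℝ) (v₂ w : ℕ → ℝ) (M : ℕ) : Prop :=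
  ∃ ustar : ℝ, 0 < ustar ∧ ∃ C : ℝ, ∃ L₀ : ℕ, ∀ L : ℕ, L₀ ≤ L → ∀ β : ℝ,
    0 < G β (L / M) → G β (L / M) ≤ ustar →
      |G β L - stepPoly v₂ w M L (G β (L / M))| ≤ C * G β (L / M) ^ 4

/-- (F1) The formal one-loop coefficient grows like `2b₀ log L` up to `O(1)`. [cite: Wolff1994, p.5] -/
def OneLoopLogGrowth (v₂ : ℕ → ℝ) : Prop :=
  ∃ D : ℝ, ∀ L : ℕ, 1 ≤ L → |v₂ L - 2 * b0 * Real.log (L : ℝ)| ≤ D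

/-- (F2) The formal connected two-loop coefficient `w = v₃ − v₂²` grows like `2b₁ log L` up to `O(1)`. [cite: Wolff1994, p.5] -/
def TwoLoopLogGrowth (w : ℕ → ℝ) : Prop :=
  ∃ D : ℝ, ∀ L : ℕ, 1 ≤ L → |w L - 2 * b1 * Real.log (L : ℝ)| ≤ D

/-- (R-BASE) At every FIXED lattice size, `1/G(β,b) = β/2 + O(1)` as `β → ∞`, uniformly on initial segments `b ≤ N` (tree level + bounded one-loop
correction; fixed-lattice Laplace asymptotics). [cite: LuscherNarayananWeiszWolff1992, §6] -/
def BaseBounded (G : ℝ → ℕ → ℝ) : Prop :=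
  ∀ N : ℕ, ∃ C β₁ : ℝ, ∀ b : ℕ, 1 ≤ b → b ≤ N → ∀ β : ℝ, β₁ ≤ β → 0 < G β b ∧ |(G β b)⁻¹ - β / 2| ≤ C

/-! ## §1 One step of the inverse coupling: `u' = u + s u² + (t+s²) u³ + O(u⁴)` ⟹ `1/u − 1/u' = s + t·u + O(u²)` -/

/-- The inversion step with explicit constants. [folklore] -/
theorem inv_step {u u' s t r A B C : ℝ} (hu : 0 < u) (hA : |s| ≤ A) (hB : |t| + s ^ 2 ≤ B) (hC : 0 ≤ C)
    (hr : |r| ≤ C * u ^ 4) (hu' : u' = u + s * u ^ 2 + (t + s ^ 2) * u ^ 3 + r)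
    (hsmall : (A + B + C + 1) * u ≤ 1 / 4) :
    3 / 4 * u ≤ u' ∧ u' ≤ 5 / 4 * u ∧ |u' - u| ≤ (A + B + C) * u ^ 2 ∧
      |u⁻¹ - u'⁻¹ - s - t * u| ≤ 4 * (C + A * B + B ^ 2) * u ^ 2 := by
  have hA0 : 0 ≤ A := (abs_nonneg s).trans hA
  have hB0 : 0 ≤ B := le_trans (by positivity) hB
  have hABC0 : 0 ≤ A + B + C := by positivity
  have hu1 : u ≤ 1 := by
    have h := le_mul_of_one_le_left hu.le (show (1:ℝ) ≤ A + B + C + 1 by linarith)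
    linarith
  have hABC : (A + B + C) * u ≤ 1 / 4 := by
    have h := mul_le_mul_of_nonneg_right (show A + B + C ≤ A + B + C + 1 by linarith) hu.le
    linarith
  have ht : |t| ≤ B := by linarith [sq_nonneg s]
  have hts : |t + s ^ 2| ≤ B := (abs_add_le _ _).trans (by rw [abs_of_nonneg (sq_nonneg s)]; exact hB)
  have hu2 : 0 < u ^ 2 := by positivity
  have hu21 : u ^ 2 ≤ 1 := by nlinarith
  have hu3 : u ^ 3 ≤ u ^ 2 := by
    calc u ^ 3 = u ^ 2 * u := by ring
      _ ≤ u ^ 2 * 1 := mul_le_mul_of_nonneg_left hu1 hu2.le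
      _ = u ^ 2 := by ring
  have hu4 : u ^ 4 ≤ u ^ 2 := by
    calc u ^ 4 = u ^ 2 * u ^ 2 := by ring
      _ ≤ u ^ 2 * 1 := mul_le_mul_of_nonneg_left hu21 hu2.le
      _ = u ^ 2 := by ring
  -- `|u' − u| ≤ (A + B + C) u²`
  have hdiff : |u' - u| ≤ (A + B + C) * u ^ 2 := by
    have h1 : u' - u = s * u ^ 2 + (t + s ^ 2) * u ^ 3 + r := by rw [hu']; ring
    rw [h1]
    have i1 : |s * u ^ 2| ≤ A * u ^ 2 := by
      rw [abs_mul, abs_of_nonneg hu2.le]; exact mul_le_mul_of_nonneg_right hA hu2.le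
    have i2 : |(t + s ^ 2) * u ^ 3| ≤ B * u ^ 2 := by
      rw [abs_mul, abs_of_nonneg (by positivity : (0:ℝ) ≤ u ^ 3)]
      calc |t + s ^ 2| * u ^ 3 ≤ B * u ^ 3 := mul_le_mul_of_nonneg_right hts (by positivity)
        _ ≤ B * u ^ 2 := mul_le_mul_of_nonneg_left hu3 hB0
    have i3 : |r| ≤ C * u ^ 2 := hr.trans (mul_le_mul_of_nonneg_left hu4 hC)
    calc |s * u ^ 2 + (t + s ^ 2) * u ^ 3 + r|
        ≤ |s * u ^ 2| + |(t + s ^ 2) * u ^ 3| + |r| := abs_add_three _ _ _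
      _ ≤ A * u ^ 2 + B * u ^ 2 + C * u ^ 2 := by linarith
      _ = (A + B + C) * u ^ 2 := by ring
  have hq : (A + B + C) * u ^ 2 ≤ 1 / 4 * u := by
    calc (A + B + C) * u ^ 2 = ((A + B + C) * u) * u := by ring
      _ ≤ 1 / 4 * u := mul_le_mul_of_nonneg_right hABC hu.le
  have hlo : 3 / 4 * u ≤ u' := by
    have := (abs_le.mp hdiff).1
    linarith
  have hhi : u' ≤ 5 / 4 * u := by
    have := (abs_le.mp hdiff).2
    linarith
  have hu'pos : 0 < u' := by linarith
  refine ⟨hlo, hhi, hdiff, ?_⟩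
  -- the key identity
  have hid : u⁻¹ - u'⁻¹ - s - t * u = ((u' - u) - (s + t * u) * (u * u')) / (u * u') := by
    field_simp
    ring
  have hN : (u' - u) - (s + t * u) * (u * u') =
      r * (1 - s * u - t * u ^ 2) - u ^ 4 * (s * (t + s ^ 2) + t * s + t * (t + s ^ 2) * u) := by
    rw [hu']; ring
  rw [hid, hN, abs_div, abs_of_pos (mul_pos hu hu'pos)]
  rw [div_le_iff₀ (mul_pos hu hu'pos)]
  -- numerator bound `≤ u⁴ (2C + 2AB + B²)`
  have hsu : |s * u| ≤ A * u := by
    rw [abs_mul, abs_of_pos hu]; exact mul_le_mul_of_nonneg_right hA hu.le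
  have htu : |t * u ^ 2| ≤ B * u := by
    rw [abs_mul, abs_of_nonneg hu2.le]
    calc |t| * u ^ 2 ≤ B * u ^ 2 := mul_le_mul_of_nonneg_right ht hu2.le
      _ = B * u * u := by ring
      _ ≤ B * u * 1 := mul_le_mul_of_nonneg_left hu1 (by positivity)
      _ = B * u := by ring
  have h1 : |1 - s * u - t * u ^ 2| ≤ 2 := by
    have a1 := abs_sub (1 - s * u) (t * u ^ 2)
    have a2 := abs_sub (1 : ℝ) (s * u)
    have hAB : A * u + B * u ≤ 1 := by nlinarith
    rw [abs_one] at a2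
    linarith
  have hT1 : |r * (1 - s * u - t * u ^ 2)| ≤ 2 * C * u ^ 4 := by
    rw [abs_mul]
    calc |r| * |1 - s * u - t * u ^ 2| ≤ (C * u ^ 4) * 2 :=
          mul_le_mul hr h1 (abs_nonneg _) (by positivity)
      _ = 2 * C * u ^ 4 := by ring
  have hT2 : |s * (t + s ^ 2) + t * s + t * (t + s ^ 2) * u| ≤ 2 * A * B + B ^ 2 := by
    have j1 : |s * (t + s ^ 2)| ≤ A * B := by
      rw [abs_mul]; exact mul_le_mul hA hts (abs_nonneg _) hA0
    have j2 : |t * s| ≤ B * A := by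
      rw [abs_mul]; exact mul_le_mul ht hA (abs_nonneg _) hB0
    have j3 : |t * (t + s ^ 2) * u| ≤ B * B := by
      rw [abs_mul, abs_mul, abs_of_pos hu]
      calc |t| * |t + s ^ 2| * u ≤ (B * B) * 1 :=
            mul_le_mul (mul_le_mul ht hts (abs_nonneg _) hB0) hu1 hu.le (by positivity)
        _ = B * B := by ring
    calc |s * (t + s ^ 2) + t * s + t * (t + s ^ 2) * u|
        ≤ |s * (t + s ^ 2)| + |t * s| + |t * (t + s ^ 2) * u| := abs_add_three _ _ _
      _ ≤ A * B + B * A + B * B := by linarith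
      _ = 2 * A * B + B ^ 2 := by ring
  have hT2' : |u ^ 4 * (s * (t + s ^ 2) + t * s + t * (t + s ^ 2) * u)| ≤ u ^ 4 * (2 * A * B + B ^ 2) := by
    rw [abs_mul, abs_of_nonneg (by positivity : (0:ℝ) ≤ u ^ 4)]
    exact mul_le_mul_of_nonneg_left hT2 (by positivity)
  have hnum : |r * (1 - s * u - t * u ^ 2) - u ^ 4 * (s * (t + s ^ 2) + t * s + t * (t + s ^ 2) * u)|
      ≤ u ^ 4 * (2 * C + 2 * A * B + B ^ 2) := by
    calc _ ≤ |r * (1 - s * u - t * u ^ 2)| + |u ^ 4 * (s * (t + s ^ 2) + t * s + t * (t + s ^ 2) * u)| := abs_sub _ _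
      _ ≤ 2 * C * u ^ 4 + u ^ 4 * (2 * A * B + B ^ 2) := add_le_add hT1 hT2'
      _ = u ^ 4 * (2 * C + 2 * A * B + B ^ 2) := by ring
  -- denominator `u u' ≥ (3/4) u²`
  have hden : 3 / 4 * u ^ 2 ≤ u * u' := by
    have := mul_le_mul_of_nonneg_left hlo hu.le
    calc 3 / 4 * u ^ 2 = u * (3 / 4 * u) := by ring
      _ ≤ u * u' := this
  have hAB0 : 0 ≤ A * B := mul_nonneg hA0 hB0
  have hK3 : u ^ 4 * (2 * C + 2 * A * B + B ^ 2) ≤ u ^ 4 * (3 * (C + A * B + B ^ 2)) :=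
    mul_le_mul_of_nonneg_left (by nlinarith [sq_nonneg B]) (by positivity)
  calc _ ≤ u ^ 4 * (2 * C + 2 * A * B + B ^ 2) := hnum
    _ ≤ u ^ 4 * (3 * (C + A * B + B ^ 2)) := hK3
    _ = 4 * (C + A * B + B ^ 2) * u ^ 2 * (3 / 4 * u ^ 2) := by ring
    _ ≤ 4 * (C + A * B + B ^ 2) * u ^ 2 * (u * u') :=
        mul_le_mul_of_nonneg_left hden (by positivity)

/-! ## §2 One step of the modified variable `z = 1/u + δ + ζ·u`: exact telescoping of the formal coefficients -/

/-- ★ §2 **The `z`-flow step.**  If `1/u − 1/u' = s + t·u + O(u²)` with `s = 2b₀ℓ + δ' − δ`, `t = 2b₁ℓ + ζ' − ζ` (`ℓ = log(L'/L) ∈ [log M, log M + 1/L]`),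
then `z − z' = 2b₀ log M + (2b₁ log M)/z + f` with `|f| ≤ 2(b₀+b₁)/L + Q₁u²`: the `δ`'s and `ζ`'s CANCEL (formal telescoping); only their sup norms
`D, D'` enter `Q₁`. [folklore] -/
theorem zflow_step {u u' s t δ δ' ζ ζ' ℓ Lr D D' A B C E W lM : ℝ}
    (hu : 0 < u) (hu' : 0 < u') (hW1 : 1 ≤ W) (hWD : 2 * (D + D') ≤ W) (hWu : W ≤ u⁻¹)
    (hδ : |δ| ≤ D) (hδ' : |δ'| ≤ D) (hζ : |ζ| ≤ D') (hζ' : |ζ'| ≤ D')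
    (hlM : 0 ≤ lM) (hLr : 1 ≤ Lr) (hℓ1 : lM ≤ ℓ) (hℓ2 : ℓ ≤ lM + 1 / Lr)
    (hs : s = 2 * b0 * ℓ + δ' - δ) (ht : t = 2 * b1 * ℓ + ζ' - ζ)
    (hstep : |u⁻¹ - u'⁻¹ - s - t * u| ≤ E * u ^ 2) (hdu : |u' - u| ≤ (A + B + C) * u ^ 2) (hABC : 0 ≤ A + B + C) :
    0 < u⁻¹ + δ + ζ * u ∧ u⁻¹ / 2 ≤ u⁻¹ + δ + ζ * u ∧ u⁻¹ + δ + ζ * u ≤ 3 / 2 * u⁻¹ ∧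
    |(u⁻¹ + δ + ζ * u) - (u'⁻¹ + δ' + ζ' * u') - 2 * b0 * lM - (2 * b1 * lM) / (u⁻¹ + δ + ζ * u)|
      ≤ 2 * (b0 + b1) / Lr + (4 * b1 * lM * (D + D') + D' * (A + B + C) + E) * u ^ 2 := by
  have hb0 : 0 < b0 := by unfold b0; positivity
  have hb1 : 0 < b1 := by unfold b1; positivity
  have hD : 0 ≤ D := (abs_nonneg δ).trans hδ
  have hD' : 0 ≤ D' := (abs_nonneg ζ).trans hζ
  set x : ℝ := u⁻¹ with hx
  have hxpos : 0 < x := inv_pos.mpr hu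
  have hxW : W ≤ x := hWu
  have hux : u = x⁻¹ := by rw [hx, inv_inv]
  have hu1 : u ≤ 1 := by
    rw [hux]; exact inv_le_one_of_one_le₀ (hW1.trans hxW)
  -- `|δ + ζ u| ≤ D + D'`
  have hcorr : |δ + ζ * u| ≤ D + D' := by
    calc |δ + ζ * u| ≤ |δ| + |ζ * u| := abs_add_le _ _
      _ ≤ D + D' * 1 := by
          rw [abs_mul, abs_of_pos hu]
          exact add_le_add hδ (mul_le_mul hζ hu1 hu.le hD')
      _ = D + D' := by ring
  set z : ℝ := x + δ + ζ * u with hz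
  have hzlo : x / 2 ≤ z := by
    have := (abs_le.mp hcorr).1
    have : x - (D + D') ≤ z := by rw [hz]; linarith
    linarith
  have hzhi : z ≤ 3 / 2 * x := by
    have := (abs_le.mp hcorr).2
    have : z ≤ x + (D + D') := by rw [hz]; linarith
    linarith
  have hzpos : 0 < z := by linarith
  refine ⟨hzpos, hzlo, hzhi, ?_⟩
  -- decomposition of `f`
  have hf : z - (u'⁻¹ + δ' + ζ' * u') - 2 * b0 * lM - (2 * b1 * lM) / z =
      (u⁻¹ - u'⁻¹ - s - t * u) + 2 * b0 * (ℓ - lM) + 2 * b1 * (ℓ - lM) * u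
        + 2 * b1 * lM * (u - 1 / z) + ζ' * (u - u') := by
    rw [hz, hs, ht, hx]; ring
  rw [hf]
  have hℓ0 : 0 ≤ ℓ - lM := by linarith
  have hℓL : ℓ - lM ≤ 1 / Lr := by linarith
  have hLr0 : 0 < Lr := by linarith
  -- term bounds
  have e1 : |2 * b0 * (ℓ - lM)| ≤ 2 * b0 / Lr := by
    rw [abs_of_nonneg (by positivity)]
    calc 2 * b0 * (ℓ - lM) ≤ 2 * b0 * (1 / Lr) := by gcongr
      _ = 2 * b0 / Lr := by ring
  have e2 : |2 * b1 * (ℓ - lM) * u| ≤ 2 * b1 / Lr := by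
    rw [abs_of_nonneg (by positivity)]
    calc 2 * b1 * (ℓ - lM) * u ≤ 2 * b1 * (1 / Lr) * 1 := by gcongr
      _ = 2 * b1 / Lr := by ring
  have e3 : |2 * b1 * lM * (u - 1 / z)| ≤ 4 * b1 * lM * (D + D') * u ^ 2 := by
    have huz : u * z = 1 + u * (δ + ζ * u) := by
      rw [hz, hx, mul_add, mul_add, mul_inv_cancel₀ hu.ne']; ring
    have hid : u - 1 / z = u * (δ + ζ * u) / z := by
      rw [eq_div_iff hzpos.ne', sub_mul, one_div, inv_mul_cancel₀ hzpos.ne']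
      linarith
    have hzinv : 1 / z ≤ 2 * u := by
      rw [div_le_iff₀ hzpos]
      have : x * u = 1 := by rw [hx]; exact inv_mul_cancel₀ hu.ne'
      nlinarith
    rw [abs_mul, abs_of_nonneg (by positivity), hid, abs_div, abs_of_pos hzpos, abs_mul, abs_of_pos hu]
    have hq : u * |δ + ζ * u| / z ≤ u * (D + D') * (2 * u) := by
      calc u * |δ + ζ * u| / z = u * |δ + ζ * u| * (1 / z) := by ring
        _ ≤ u * (D + D') * (2 * u) :=
            mul_le_mul (mul_le_mul_of_nonneg_left hcorr hu.le) hzinv (by positivity) (by positivity)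
    calc 2 * b1 * lM * (u * |δ + ζ * u| / z) ≤ 2 * b1 * lM * (u * (D + D') * (2 * u)) :=
          mul_le_mul_of_nonneg_left hq (by positivity)
      _ = 4 * b1 * lM * (D + D') * u ^ 2 := by ring
  have e4 : |ζ' * (u - u')| ≤ D' * (A + B + C) * u ^ 2 := by
    rw [abs_mul, ← abs_neg (u - u'), neg_sub]
    calc |ζ'| * |u' - u| ≤ D' * ((A + B + C) * u ^ 2) := mul_le_mul hζ' hdu (abs_nonneg _) hD'
      _ = D' * (A + B + C) * u ^ 2 := by ring
  calc |(u⁻¹ - u'⁻¹ - s - t * u) + 2 * b0 * (ℓ - lM) + 2 * b1 * (ℓ - lM) * u + 2 * b1 * lM * (u - 1 / z) + ζ' * (u - u')|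
      ≤ |u⁻¹ - u'⁻¹ - s - t * u| + |2 * b0 * (ℓ - lM)| + |2 * b1 * (ℓ - lM) * u| + |2 * b1 * lM * (u - 1 / z)| + |ζ' * (u - u')| := by
        have a1 := abs_add_le (u⁻¹ - u'⁻¹ - s - t * u + 2 * b0 * (ℓ - lM) + 2 * b1 * (ℓ - lM) * u + 2 * b1 * lM * (u - 1 / z)) (ζ' * (u - u'))
        have a2 := abs_add_le (u⁻¹ - u'⁻¹ - s - t * u + 2 * b0 * (ℓ - lM) + 2 * b1 * (ℓ - lM) * u) (2 * b1 * lM * (u - 1 / z))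
        have a3 := abs_add_le (u⁻¹ - u'⁻¹ - s - t * u + 2 * b0 * (ℓ - lM)) (2 * b1 * (ℓ - lM) * u)
        have a4 := abs_add_le (u⁻¹ - u'⁻¹ - s - t * u) (2 * b0 * (ℓ - lM))
        linarith
    _ ≤ E * u ^ 2 + 2 * b0 / Lr + 2 * b1 / Lr + 4 * b1 * lM * (D + D') * u ^ 2 + D' * (A + B + C) * u ^ 2 := by
        linarith [hstep, e1, e2, e3, e4]
    _ = 2 * (b0 + b1) / Lr + (4 * b1 * lM * (D + D') + D' * (A + B + C) + E) * u ^ 2 := by ring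

/-! ## §3 Tower arithmetic: `L_i = ⌊L / M^{k−i}⌋`, `L_i = ⌊L_{i+1}/M⌋`, `L_0 ∈ [N, NM)` -/

/-- Level `i` of the `k`-step tower under `L` with block factor `M`. -/
def tower (L M k i : ℕ) : ℕ := L / M ^ (k - i)

theorem tower_top (L M k : ℕ) : tower L M k k = L := by
  simp [tower]

theorem tower_step {L M k i : ℕ} (hi : i < k) : tower L M k i = tower L M k (i + 1) / M := by
  unfold tower
  have : k - i = (k - (i + 1)) + 1 := by omega
  rw [this, pow_succ, Nat.div_div_eq_div_mul]

theorem tower_zero_of_le {L M k j : ℕ} (hj : j ≤ k) : tower L M k 0 = tower L M k j / M ^ j := by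
  unfold tower
  rw [Nat.sub_zero, Nat.div_div_eq_div_mul, ← pow_add, Nat.sub_add_cancel hj]

theorem tower_lower {L M k i N : ℕ} (hM : 0 < M) (hNL : N * M ^ k ≤ L) (hi : i ≤ k) : N * M ^ i ≤ tower L M k i := by
  unfold tower
  apply (Nat.le_div_iff_mul_le (by positivity)).2
  calc N * M ^ i * M ^ (k - i) = N * M ^ k := by rw [mul_assoc, ← pow_add, Nat.add_sub_cancel' hi]
    _ ≤ L := hNL

theorem tower_zero_lt {L M k N : ℕ} (hM : 0 < M) (hL : L < N * M ^ (k + 1)) : tower L M k 0 < N * M := by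
  unfold tower
  rw [Nat.sub_zero]
  apply (Nat.div_lt_iff_lt_mul (by positivity)).2
  calc L < N * M ^ (k + 1) := hL
    _ = N * M * M ^ k := by rw [pow_succ]; ring

/-- Choice of the number of steps: `N·M^k ≤ L < N·M^{k+1}`. [folklore] -/
theorem exists_level {L M N : ℕ} (hM : 2 ≤ M) (hN : 1 ≤ N) (hNL : N ≤ L) :
    ∃ k : ℕ, N * M ^ k ≤ L ∧ L < N * M ^ (k + 1) := by
  have hLN : 0 < L / N := Nat.div_pos hNL (by omega)
  refine ⟨Nat.log M (L / N), ?_, ?_⟩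
  · have h1 : M ^ Nat.log M (L / N) ≤ L / N := Nat.pow_log_le_self M (by omega)
    calc N * M ^ Nat.log M (L / N) ≤ N * (L / N) := Nat.mul_le_mul_left _ h1
      _ ≤ L := Nat.mul_div_le L N
  · have h2 : L / N < M ^ (Nat.log M (L / N) + 1) := Nat.lt_pow_succ_log_self (by omega) _
    have h3 := (Nat.div_lt_iff_lt_mul (by omega)).1 h2
    linarith [Nat.mul_comm (M ^ (Nat.log M (L / N) + 1)) N]

/-- Real logarithms of one tower step: with `L'' = ⌊L'/M⌋ ≥ 1`, `log M ≤ log L' − log L'' ≤ log M + 1/L''`. [folklore] -/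
theorem log_step_bounds {M L' L'' : ℕ} (hM : 1 ≤ M) (hL'' : 1 ≤ L'') (hdiv : L'' = L' / M) :
    Real.log M ≤ Real.log (L' : ℝ) - Real.log (L'' : ℝ) ∧
      Real.log (L' : ℝ) - Real.log (L'' : ℝ) ≤ Real.log M + 1 / (L'' : ℝ) := by
  have hMpos : 0 < M := by omega
  have h1 : L'' * M ≤ L' := by rw [hdiv]; exact Nat.div_mul_le_self L' M
  have h2 : L' < L'' * M + M := by rw [hdiv]; exact Nat.lt_div_mul_add hMpos
  have hM' : (1 : ℝ) ≤ M := by exact_mod_cast hM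
  have hL''r : (1 : ℝ) ≤ L'' := by exact_mod_cast hL''
  have hL''pos : (0 : ℝ) < L'' := by linarith
  have hL'pos : (0 : ℝ) < L' := by
    have : (L'' : ℝ) * M ≤ L' := by exact_mod_cast h1
    nlinarith
  constructor
  · have : (L'' : ℝ) * M ≤ L' := by exact_mod_cast h1
    have := Real.log_le_log (by positivity) this
    rw [Real.log_mul hL''pos.ne' (by positivity)] at this
    linarith
  · have h2r : (L' : ℝ) < (L'' + 1) * M := by
      have : (L' : ℝ) < L'' * M + M := by exact_mod_cast h2
      linarith
    have h3 := Real.log_lt_log hL'pos h2r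
    rw [Real.log_mul (by positivity) (by positivity)] at h3
    -- `log(L''+1) − log L'' ≤ 1/L''`
    have h4 : Real.log ((L'' : ℝ) + 1) - Real.log (L'' : ℝ) ≤ 1 / (L'' : ℝ) := by
      rw [← Real.log_div (by positivity) hL''pos.ne']
      have h5 := Real.log_le_sub_one_of_pos (show 0 < ((L'' : ℝ) + 1) / L'' by positivity)
      have h6 : ((L'' : ℝ) + 1) / L'' - 1 = 1 / L'' := by field_simp; ring
      linarith
    linarith

/-- E1-tower condition for `flowJunction` with ONE extra (bare) step: if `L₀ = ⌊L_j / M^j⌋`, `b = ⌊L₀/M⌋ ≥ 1` then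
`|log L_j − log b − (j+1)·log M| ≤ 1`. [folklore] -/
theorem tower_log_condition {M Lj L0 b j : ℕ} (hM : 2 ≤ M) (hb : 1 ≤ b) (hL0 : L0 = Lj / M ^ j) (hbdef : b = L0 / M) :
    |Real.log (Lj : ℝ) - Real.log (b : ℝ) - ((j + 1 : ℕ) : ℝ) * Real.log (M : ℝ)| ≤ 1 := by
  have hMpos : 0 < M := by omega
  -- `b M^{j+1} ≤ Lj < 2 b M^{j+1}`
  have h1 : b * M ≤ L0 := by rw [hbdef]; exact Nat.div_mul_le_self L0 M
  have h2 : L0 < b * M + M := by rw [hbdef]; exact Nat.lt_div_mul_add hMpos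
  have h3 : L0 * M ^ j ≤ Lj := by rw [hL0]; exact Nat.div_mul_le_self Lj (M ^ j)
  have h4 : Lj < L0 * M ^ j + M ^ j := by rw [hL0]; exact Nat.lt_div_mul_add (by positivity)
  have hlo : b * M ^ (j + 1) ≤ Lj := by
    calc b * M ^ (j + 1) = b * M * M ^ j := by rw [pow_succ]; ring
      _ ≤ L0 * M ^ j := Nat.mul_le_mul_right _ h1
      _ ≤ Lj := h3
  have hhi : Lj < 2 * (b * M ^ (j + 1)) := by
    have h5 : L0 + 1 ≤ (b + 1) * M := by
      have : L0 + 1 ≤ b * M + M := h2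
      linarith [Nat.add_mul b 1 M]
    calc Lj < (L0 + 1) * M ^ j := by linarith [Nat.add_mul L0 1 (M ^ j)]
      _ ≤ (b + 1) * M * M ^ j := Nat.mul_le_mul_right _ h5
      _ = (b + 1) * M ^ (j + 1) := by rw [pow_succ]; ring
      _ ≤ (2 * b) * M ^ (j + 1) := Nat.mul_le_mul_right _ (by omega)
      _ = 2 * (b * M ^ (j + 1)) := by ring
  have hbr : (1 : ℝ) ≤ b := by exact_mod_cast hb
  have hMr : (2 : ℝ) ≤ M := by exact_mod_cast hM
  have hQpos : (0 : ℝ) < (b : ℝ) * (M : ℝ) ^ (j + 1) := by positivity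
  have hlor : (b : ℝ) * (M : ℝ) ^ (j + 1) ≤ Lj := by exact_mod_cast hlo
  have hhir : (Lj : ℝ) < 2 * ((b : ℝ) * (M : ℝ) ^ (j + 1)) := by exact_mod_cast hhi
  have hLjpos : (0 : ℝ) < Lj := lt_of_lt_of_le hQpos hlor
  have hlogQ : Real.log ((b : ℝ) * (M : ℝ) ^ (j + 1)) = Real.log (b : ℝ) + ((j + 1 : ℕ) : ℝ) * Real.log (M : ℝ) := by
    rw [Real.log_mul (by positivity) (by positivity), Real.log_pow]
  have hA := Real.log_le_log hQpos hlor
  have hB := Real.log_lt_log hLjpos hhir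
  rw [Real.log_mul (by norm_num) hQpos.ne'] at hB
  rw [hlogQ] at hA hB
  have hlog2 : Real.log (2 : ℝ) ≤ 1 := by
    have := Real.log_two_lt_d9; linarith
  rw [abs_le]; constructor <;> linarith

/-! ## §4 The remainder bootstrap (with the tree's `inv_sq_sum_le`) -/

/-- If along `y_i − y_{i+1} = a + κa/y_i + e_i` (floor `y ≥ m ≥ 1`) the remainders obey the SELF-REFERENTIAL budget
`Σ|e_i| ≤ P + Q·Σ 1/y_i²` with `m²a ≥ 4Q`, then `Σ|e_i| ≤ 2P + 2Q/(ma)`. [folklore] -/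
theorem remainder_bootstrap {y e : ℕ → ℝ} {a κa m P Q : ℝ} {K : ℕ} (ha : 0 < a) (hκa : 0 ≤ κa) (hm : 1 ≤ m)
    (hQ : 0 ≤ Q) (hmQ : 4 * Q ≤ m ^ 2 * a)
    (hy : ∀ i, i ≤ K → m ≤ y i) (hflow : ∀ i, i < K → y i - y (i + 1) = a + κa / y i + e i)
    (hbudget : ∑ i ∈ Finset.range K, |e i| ≤ P + Q * ∑ i ∈ Finset.range K, 1 / y i ^ 2) :
    ∑ i ∈ Finset.range K, |e i| ≤ 2 * P + 2 * Q / (m * a) := by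
  have hmpos : 0 < m := by linarith
  set R' : ℝ := ∑ i ∈ Finset.range K, |e i| with hR'
  have hd : ∀ i, i < K → a - |e i| ≤ y i - y (i + 1) := by
    intro i hi
    rw [hflow i hi]
    have hyi : 0 < y i := lt_of_lt_of_le hmpos (hy i hi.le)
    have : 0 ≤ κa / y i := by positivity
    linarith [neg_abs_le (e i)]
  have hS := TowerFlow.inv_sq_sum_le (r := fun i => |e i|) (R := R') ha hmpos (fun i _ => abs_nonneg _) le_rfl hy hd
  -- `R' ≤ P + Q (1/m + 2R'/m²)/a`
  have h1 : R' ≤ P + Q * ((1 / m + 2 * R' / m ^ 2) / a) := hbudget.trans (by gcongr)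
  have h2 : Q * ((1 / m + 2 * R' / m ^ 2) / a) = Q / (m * a) + (2 * Q / (m ^ 2 * a)) * R' := by
    field_simp
  have h3 : 2 * Q / (m ^ 2 * a) ≤ 1 / 2 := by
    rw [div_le_iff₀ (by positivity)]; linarith
  have hR'0 : 0 ≤ R' := Finset.sum_nonneg fun i _ => abs_nonneg _
  have h4 : (2 * Q / (m ^ 2 * a)) * R' ≤ (1 / 2) * R' := mul_le_mul_of_nonneg_right h3 hR'0
  have h5 : R' ≤ P + Q / (m * a) + (1 / 2) * R' := by linarith [h1, h2, h4]
  have h6 : R' ≤ 2 * P + 2 * (Q / (m * a)) := by linarith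
  calc R' ≤ 2 * P + 2 * (Q / (m * a)) := h6
    _ = 2 * P + 2 * Q / (m * a) := by ring

/-! ## §5 ★ CAL-X from formal telescoping -/

/-- The label `1/ḡ²(β,L)` is antitone in `L`. [folklore] -/
theorem invRunningCoupling_antitone {β : ℝ} {L L' : ℕ} (hL' : 1 ≤ L') (hle : L' ≤ L) :
    invRunningCoupling β L ≤ invRunningCoupling β L' := by
  rw [BOHandover.invRunningCoupling_eq, BOHandover.invRunningCoupling_eq]
  have hb0 : 0 < b0 := by unfold b0; positivity
  have h1 : (1 : ℝ) ≤ L' := by exact_mod_cast hL'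
  have h2 : (L' : ℝ) ≤ L := by exact_mod_cast hle
  have := Real.log_le_log (by linarith) h2
  nlinarith

set_option maxHeartbeats 4000000 in
/-- ★★ §5 **CAL-X from FORMAL TELESCOPING.**  A value-free third-order step expansion of ONE observable under ONE coarsening (`StepExpansion`),
the log-growth of its two formal coefficients (`OneLoopLogGrowth`, `TwoLoopLogGrowth`: the only entrance of `b₀, b₁`) and fixed-lattice tree-level
matching (`BaseBounded`) imply the two-loop calibration `CalX G` of the gen-3 split — by exact telescoping along `L_i = ⌊L/M^{k−i}⌋` in the modified
variable `z = 1/G + δ + ζ·G` and the tree's two-loop flow junction.  0 sorry. [cite: Wolff1994, p.5] [cite: LuscherWeiszWolff1991, §2] -/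
theorem calX_of_formalTelescoping {G : ℝ → ℕ → ℝ} {v₂ w : ℕ → ℝ} {M : ℕ} (hM : 2 ≤ M)
    (hS : StepExpansion G v₂ w M) (h1 : OneLoopLogGrowth v₂) (h2 : TwoLoopLogGrowth w) (hB : BaseBounded G) :
    CalX G := by
  have hb0 : 0 < b0 := by unfold b0; positivity
  have hb1 : 0 < b1 := by unfold b1; positivity
  have hb0le : b0 ≤ 1 := by
    unfold b0
    rw [div_le_one (by positivity)]
    nlinarith [Real.pi_gt_three]
  have hκ : 0 ≤ b1 / b0 := (div_pos hb1 hb0).le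
  -- ### data
  obtain ⟨ustar, hustar, C₀, L₀, hSE⟩ := hS
  obtain ⟨D₀, hD₀⟩ := h1
  obtain ⟨D₀', hD₀'⟩ := h2
  set C : ℝ := max C₀ 0 with hCdef
  have hC0 : 0 ≤ C := le_max_right _ _
  set D : ℝ := max D₀ 0 with hDdef
  have hD0 : 0 ≤ D := le_max_right _ _
  set D' : ℝ := max D₀' 0 with hD'def
  have hD'0 : 0 ≤ D' := le_max_right _ _
  have hδb : ∀ n : ℕ, 1 ≤ n → |v₂ n - 2 * b0 * Real.log (n : ℝ)| ≤ D :=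
    fun n hn => (hD₀ n hn).trans (le_max_left _ _)
  have hζb : ∀ n : ℕ, 1 ≤ n → |w n - 2 * b1 * Real.log (n : ℝ)| ≤ D' :=
    fun n hn => (hD₀' n hn).trans (le_max_left _ _)
  have hSE' : ∀ L : ℕ, L₀ ≤ L → ∀ β : ℝ, 0 < G β (L / M) → G β (L / M) ≤ ustar →
      |G β L - stepPoly v₂ w M L (G β (L / M))| ≤ C * G β (L / M) ^ 4 := by
    intro L hL β hp hu
    exact (hSE L hL β hp hu).trans (mul_le_mul_of_nonneg_right (le_max_left _ _) (by positivity))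
  have hMpos : 0 < M := by omega
  have hMr : (2 : ℝ) ≤ M := by exact_mod_cast hM
  have hM1 : (1 : ℝ) < M := by linarith
  set lM : ℝ := Real.log (M : ℝ) with hlMdef
  have hlMpos : 0 < lM := Real.log_pos hM1
  set a : ℝ := 2 * b0 * lM with hadef
  have hapos : 0 < a := by positivity
  set κa : ℝ := (b1 / b0) * (2 * b0 * lM) with hκadef
  have hκa_eq : κa = 2 * b1 * lM := by rw [hκadef]; field_simp
  have hκa0 : 0 ≤ κa := by rw [hκa_eq]; positivity
  set A : ℝ := 2 * b0 * (lM + 1) + 2 * D with hAdef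
  have hA0 : 0 ≤ A := by positivity
  set B : ℝ := 2 * b1 * (lM + 1) + 2 * D' + A ^ 2 with hBdef
  have hB0 : 0 ≤ B := by positivity
  set E : ℝ := 4 * (C + A * B + B ^ 2) with hEdef
  have hE0 : 0 ≤ E := by positivity
  set Q₁ : ℝ := 4 * b1 * lM * (D + D') + D' * (A + B + C) + E with hQ₁def
  have hQ₁0 : 0 ≤ Q₁ := by positivity
  set N : ℕ := max (max L₀ M) 4 with hNdef
  have hNL₀ : L₀ ≤ N := le_trans (le_max_left _ _) (le_max_left _ _)
  have hNM : M ≤ N := le_trans (le_max_right _ _) (le_max_left _ _)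
  have hN4 : 4 ≤ N := le_max_right _ _
  have hN1 : 1 ≤ N := by omega
  have hNr : (1 : ℝ) ≤ N := by exact_mod_cast hN1
  have hNpos : (0 : ℝ) < N := by linarith
  obtain ⟨CB₀, β₁, hbase⟩ := hB (N * M)
  set CB : ℝ := max CB₀ 0 with hCBdef
  have hCB0 : 0 ≤ CB := le_max_right _ _
  set Rinit : ℝ := CB + D + D' + a + 2 * κa with hRinitdef
  have hRinit0 : 0 ≤ Rinit := by positivity
  set P : ℝ := Rinit + 4 * (b0 + b1) / N with hPdef
  have hP0 : 0 ≤ P := by positivity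
  set Qc : ℝ := 4 * Q₁ with hQcdef
  have hQc0 : 0 ≤ Qc := by positivity
  set R : ℝ := 2 * P + 2 with hRdef
  have hR0 : 0 ≤ R := by positivity
  set m : ℝ := max 1 (max (2 * (a + κa + R)) (4 * Qc / a)) with hmdef
  have hm1 : 1 ≤ m := le_max_left _ _
  have hmpos : 0 < m := by linarith
  have hm2 : 2 * (a + κa + R) ≤ m := le_trans (le_max_left _ _) (le_max_right _ _)
  have hm3 : 4 * Qc / a ≤ m := le_trans (le_max_right _ _) (le_max_right _ _)
  have hm3' : 4 * Qc ≤ m * a := by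
    have := hm3; rwa [div_le_iff₀ hapos] at this
  set W : ℝ := max (max 1 (m + 2 * (D + D' + 1))) (max ustar⁻¹ (4 * (A + B + C + 1))) with hWdef
  have hW1 : 1 ≤ W := le_trans (le_max_left _ _) (le_max_left _ _)
  have hWpos : 0 < W := by linarith
  have hWm : m + 2 * (D + D' + 1) ≤ W := le_trans (le_max_right _ _) (le_max_left _ _)
  have hWu : ustar⁻¹ ≤ W := le_trans (le_max_left _ _) (le_max_right _ _)
  have hWABC : 4 * (A + B + C + 1) ≤ W := le_trans (le_max_right _ _) (le_max_right _ _)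
  have hWD : 2 * (D + D') ≤ W := by linarith
  set Φs : ℝ := (b1 / b0) * (((b1 / b0) * (2 * b0 * lM) + m ^ 2 / 2) * ((1 / m + 2 * R / m ^ 2) / (2 * b0 * lM)) + R / m)
      + R + 2 * b0 * (Real.log (N : ℝ) + 1) with hΦsdef
  have hlogN : 0 ≤ Real.log (N : ℝ) := Real.log_nonneg hNr
  have hΦs0 : 0 ≤ Φs := by positivity
  set X' : ℝ := 2 * W + D + D' with hX'def
  have hlog2 : 0 ≤ Real.log (2 : ℝ) := Real.log_nonneg (by norm_num)
  set Φss : ℝ := Φs + (D + D') + (b1 / b0) * Real.log 2 with hΦssdef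
  have hΦss0 : 0 ≤ Φss := by positivity
  -- ### the target
  intro η hη
  set η' : ℝ := min η 1 / 2 with hη'def
  have hmin : 0 < min η 1 := lt_min hη one_pos
  have hη'pos : 0 < η' := by positivity
  have hη'le : 2 * η' ≤ η := by
    have : min η 1 ≤ η := min_le_left _ _
    have : 2 * η' = min η 1 := by rw [hη'def]; ring
    linarith
  have hη'1 : 2 * η' ≤ 1 := by
    have : min η 1 ≤ 1 := min_le_right _ _
    have : 2 * η' = min η 1 := by rw [hη'def]; ring
    linarith
  obtain ⟨Y, hYpos, hY⟩ := TowerFlow.ratio_near_one_of_abs_sub_le_log hκ hb0 hΦss0 hη'pos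
  set βthr : ℝ := max (max β₁ 1) (max (2 * (2 * W + CB)) (2 * m)) with hβthrdef
  set V : ℝ := max (max (Φs + X') Y) (max βthr 1) with hVdef
  have hV1 : 1 ≤ V := le_trans (le_max_right _ _) (le_max_right _ _)
  have hVpos : 0 < V := by linarith
  have hVX : Φs + X' ≤ V := le_trans (le_max_left _ _) (le_max_left _ _)
  have hVY : Y ≤ V := le_trans (le_max_right _ _) (le_max_left _ _)
  have hVβ : βthr ≤ V := le_trans (le_max_left _ _) (le_max_right _ _)
  have hq0 : (0 : ℝ) < 1 / (8 * V) := by positivity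
  set lam0 : ℝ := (1 / (8 * V)) ^ ((1 : ℝ) / 3) with hlam0def
  have hlam0pos : 0 < lam0 := Real.rpow_pos_of_pos hq0 _
  have hlam0cube : lam0 ^ 3 = 1 / (8 * V) := by
    rw [hlam0def, ← Real.rpow_natCast, ← Real.rpow_mul hq0.le]
    norm_num
  refine ⟨lam0, hlam0pos, fun lam hlam hlamle => ⟨N, fun L _ hNL β hWin => ?_⟩⟩
  -- ### window labels
  have hβ1 : 1 ≤ β := hWin.1
  have hβpos : 0 < β := by linarith
  have hl : 0 < luscherLambda β L := luscherLambda_pos_of_window hlam hWin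
  have hinvpos : 0 < invRunningCoupling β L := BOHandover.invRunningCoupling_pos_of_luscherLambda_pos hl
  have hlam3 : lam ^ 3 ≤ 1 / (8 * V) := by
    rw [← hlam0cube]; exact pow_le_pow_left₀ hlam.le hlamle 3
  have hVinv : V ≤ invRunningCoupling β L := by
    have h3 := BOHandover.luscherLambda_pow_three hinvpos
    have hle : luscherLambda β L ≤ 2 * lam := hWin.2.2
    have h4 : luscherLambda β L ^ 3 ≤ (2 * lam) ^ 3 := pow_le_pow_left₀ hl.le hle 3
    have h5 : (invRunningCoupling β L)⁻¹ ≤ V⁻¹ := by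
      rw [← h3]
      calc luscherLambda β L ^ 3 ≤ (2 * lam) ^ 3 := h4
        _ = 8 * lam ^ 3 := by ring
        _ ≤ 8 * (1 / (8 * V)) := by linarith
        _ = V⁻¹ := by field_simp
    exact (inv_le_inv₀ hinvpos hVpos).1 h5
  have hβV : 2 * V ≤ β := by
    have h6 := BOHandover.beta_ge_of_window hlam hWin
    have hl3 : 0 < lam ^ 3 := by positivity
    have h7 : 2 * V ≤ 1 / (4 * lam ^ 3) := by
      rw [le_div_iff₀ (by positivity)]
      have : 2 * V * (4 * lam ^ 3) = 8 * V * lam ^ 3 := by ring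
      rw [this]
      calc 8 * V * lam ^ 3 ≤ 8 * V * (1 / (8 * V)) := mul_le_mul_of_nonneg_left hlam3 (by positivity)
        _ = 1 := by field_simp
    linarith
  have hββ₁ : β₁ ≤ β := by
    have : β₁ ≤ βthr := le_trans (le_max_left _ _) (le_max_left _ _)
    linarith
  have hβW : 2 * (2 * W + CB) ≤ β := by
    have : 2 * (2 * W + CB) ≤ βthr := le_trans (le_max_left _ _) (le_max_right _ _)
    linarith
  have hβm : 2 * m ≤ β := by
    have : 2 * m ≤ βthr := le_trans (le_max_right _ _) (le_max_right _ _)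
    linarith
  -- ### the tower
  obtain ⟨k, hk1, hk2⟩ := exists_level hM hN1 hNL
  set Li : ℕ → ℕ := fun i => tower L M k i with hLidef
  have hLiN : ∀ i, i ≤ k → N * M ^ i ≤ Li i := fun i hi => tower_lower hMpos hk1 hi
  have hLiN' : ∀ i, i ≤ k → N ≤ Li i := fun i hi =>
    le_trans (Nat.le_mul_of_pos_right N (by positivity)) (hLiN i hi)
  have hLi1 : ∀ i, i ≤ k → 1 ≤ Li i := fun i hi => le_trans hN1 (hLiN' i hi)
  have hLi2 : ∀ i, i ≤ k → (N : ℝ) * 2 ^ i ≤ (Li i : ℝ) := by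
    intro i hi
    have h8 : N * 2 ^ i ≤ Li i := le_trans (Nat.mul_le_mul_left _ (Nat.pow_le_pow_left hM i)) (hLiN i hi)
    exact_mod_cast h8
  have hLitop : Li k = L := tower_top L M k
  have hListep : ∀ i, i < k → Li i = Li (i + 1) / M := fun i hi => tower_step hi
  have hLile : ∀ i, i ≤ k → Li i ≤ L := fun i _ => Nat.div_le_self _ _
  have hL0lt : Li 0 < N * M := tower_zero_lt hMpos hk2
  -- ### the sequences
  set u : ℕ → ℝ := fun i => G β (Li i) with hudef
  set x : ℕ → ℝ := fun i => (u i)⁻¹ with hxdef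
  set δs : ℕ → ℝ := fun i => v₂ (Li i) - 2 * b0 * Real.log (Li i : ℝ) with hδsdef
  set ζs : ℕ → ℝ := fun i => w (Li i) - 2 * b1 * Real.log (Li i : ℝ) with hζsdef
  set z : ℕ → ℝ := fun i => x i + δs i + ζs i * u i with hzdef
  set y : ℕ → ℝ := fun i => if i = 0 then β / 2 else z (i - 1) with hydef
  set e : ℕ → ℝ := fun i => y i - y (i + 1) - a - κa / y i with hedef
  have hy0 : y 0 = β / 2 := by
    show (if (0 : ℕ) = 0 then β / 2 else z (0 - 1)) = β / 2
    rw [if_pos rfl]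
  have hysucc : ∀ i, y (i + 1) = z i := by
    intro i
    show (if i + 1 = 0 then β / 2 else z (i + 1 - 1)) = z i
    rw [if_neg (Nat.succ_ne_zero i), Nat.add_sub_cancel]
  have he_def : ∀ i, e i = y i - y (i + 1) - a - κa / y i := fun i => rfl
  have he_succ : ∀ i, e (i + 1) = z i - z (i + 1) - a - κa / z i := by
    intro i; rw [he_def, hysucc, hysucc]
  have he_zero : e 0 = β / 2 - z 0 - a - κa / (β / 2) := by
    rw [he_def, hysucc, hy0]
  have hx_def : ∀ i, x i = (u i)⁻¹ := fun i => rfl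
  have hz_def : ∀ i, z i = x i + δs i + ζs i * u i := fun i => rfl
  have hu_def : ∀ i, u i = G β (Li i) := fun i => rfl
  have hδs : ∀ i, i ≤ k → |δs i| ≤ D := fun i hi => hδb (Li i) (hLi1 i hi)
  have hζs : ∀ i, i ≤ k → |ζs i| ≤ D' := fun i hi => hζb (Li i) (hLi1 i hi)
  -- `z` versus `x` under the weak floor
  have hzx : ∀ i, i ≤ k → W ≤ x i → 0 < u i → |z i - x i| ≤ D + D' ∧ u i ≤ 1 := by
    intro i hi hWi hui
    have hu1 : u i ≤ 1 := by
      have h9 : u i * W ≤ u i * x i := mul_le_mul_of_nonneg_left hWi hui.le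
      rw [hx_def, mul_inv_cancel₀ hui.ne'] at h9
      calc u i = u i * 1 := by ring
        _ ≤ u i * W := mul_le_mul_of_nonneg_left hW1 hui.le
        _ ≤ 1 := h9
    refine ⟨?_, hu1⟩
    have h10 : z i - x i = δs i + ζs i * u i := by rw [hz_def]; ring
    rw [h10]
    calc |δs i + ζs i * u i| ≤ |δs i| + |ζs i * u i| := abs_add_le _ _
      _ ≤ D + D' * 1 := by
          rw [abs_mul, abs_of_pos hui]
          exact add_le_add (hδs i hi) (mul_le_mul (hζs i hi) hu1 hui.le hD'0)
      _ = D + D' := by ring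
  -- ### one tower step from the weak floor
  have stepFacts : ∀ i, i < k → W ≤ x i → 0 < u i →
      0 < u (i + 1) ∧ 4 / 5 * x i ≤ x (i + 1) ∧
        |z i - z (i + 1) - a - κa / z i| ≤ 2 * (b0 + b1) / (Li i : ℝ) + Q₁ * (u i) ^ 2 ∧
        (u i) ^ 2 ≤ 4 / (z i) ^ 2 := by
    intro i hi hWi hui
    have hik : i ≤ k := hi.le
    have hi1k : i + 1 ≤ k := hi
    -- the step expansion at `L' = L_{i+1}`
    have hdiv : Li i = Li (i + 1) / M := hListep i hi
    have hL'₀ : L₀ ≤ Li (i + 1) := le_trans hNL₀ (hLiN' (i + 1) hi1k)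
    have hxpos : 0 < x i := by rw [hx_def]; exact inv_pos.mpr hui
    have huW : u i ≤ W⁻¹ := by
      have := (inv_le_inv₀ hxpos hWpos).2 hWi
      rwa [hx_def, inv_inv] at this
    have hu_ustar : u i ≤ ustar := by
      calc u i ≤ W⁻¹ := huW
        _ ≤ ustar⁻¹⁻¹ := (inv_le_inv₀ hWpos (by positivity)).2 hWu
        _ = ustar := inv_inv _
    have hGi : G β (Li (i + 1) / M) = u i := by rw [← hdiv]
    have hSEi := hSE' (Li (i + 1)) hL'₀ β (by rw [hGi]; exact hui) (by rw [hGi]; exact hu_ustar)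
    rw [hGi] at hSEi
    -- the formal coefficients of this step
    set ℓ : ℝ := Real.log (Li (i + 1) : ℝ) - Real.log (Li i : ℝ) with hℓdef
    have hlog := log_step_bounds (M := M) (L' := Li (i + 1)) (L'' := Li i) (by omega) (hLi1 i hik) hdiv
    have hℓ1 : lM ≤ ℓ := hlog.1
    have hℓ2 : ℓ ≤ lM + 1 / (Li i : ℝ) := hlog.2
    have hLir : (1 : ℝ) ≤ (Li i : ℝ) := by exact_mod_cast hLi1 i hik
    have hLipos : (0 : ℝ) < (Li i : ℝ) := by linarith
    have hℓ3 : ℓ ≤ lM + 1 := by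
      have : 1 / (Li i : ℝ) ≤ 1 := by rw [div_le_one hLipos]; exact hLir
      linarith
    have hℓ0 : 0 ≤ ℓ := by linarith
    set s : ℝ := stepOne v₂ M (Li (i + 1)) with hsdef
    set t : ℝ := stepTwo w M (Li (i + 1)) with htdef
    have hs : s = 2 * b0 * ℓ + δs (i + 1) - δs i := by
      show v₂ (Li (i + 1)) - v₂ (Li (i + 1) / M) = _
      rw [← hdiv, hℓdef]
      show v₂ (Li (i + 1)) - v₂ (Li i) = 2 * b0 * (Real.log (Li (i + 1) : ℝ) - Real.log (Li i : ℝ))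
        + (v₂ (Li (i + 1)) - 2 * b0 * Real.log (Li (i + 1) : ℝ)) - (v₂ (Li i) - 2 * b0 * Real.log (Li i : ℝ))
      ring
    have ht : t = 2 * b1 * ℓ + ζs (i + 1) - ζs i := by
      show w (Li (i + 1)) - w (Li (i + 1) / M) = _
      rw [← hdiv, hℓdef]
      show w (Li (i + 1)) - w (Li i) = 2 * b1 * (Real.log (Li (i + 1) : ℝ) - Real.log (Li i : ℝ))
        + (w (Li (i + 1)) - 2 * b1 * Real.log (Li (i + 1) : ℝ)) - (w (Li i) - 2 * b1 * Real.log (Li i : ℝ))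
      ring
    have hsA : |s| ≤ A := by
      rw [hs]
      have e1 : |2 * b0 * ℓ| ≤ 2 * b0 * (lM + 1) := by
        rw [abs_of_nonneg (by positivity)]
        exact mul_le_mul_of_nonneg_left hℓ3 (by positivity)
      calc |2 * b0 * ℓ + δs (i + 1) - δs i| ≤ |2 * b0 * ℓ| + |δs (i + 1)| + |δs i| := by
            have := abs_sub (2 * b0 * ℓ + δs (i + 1)) (δs i)
            have := abs_add_le (2 * b0 * ℓ) (δs (i + 1))
            linarith
        _ ≤ 2 * b0 * (lM + 1) + D + D := by linarith [hδs (i + 1) hi1k, hδs i hik]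
        _ = A := by rw [hAdef]; ring
    have htB : |t| + s ^ 2 ≤ B := by
      have e2 : |t| ≤ 2 * b1 * (lM + 1) + 2 * D' := by
        rw [ht]
        have e1 : |2 * b1 * ℓ| ≤ 2 * b1 * (lM + 1) := by
          rw [abs_of_nonneg (by positivity)]
          exact mul_le_mul_of_nonneg_left hℓ3 (by positivity)
        calc |2 * b1 * ℓ + ζs (i + 1) - ζs i| ≤ |2 * b1 * ℓ| + |ζs (i + 1)| + |ζs i| := by
              have := abs_sub (2 * b1 * ℓ + ζs (i + 1)) (ζs i)
              have := abs_add_le (2 * b1 * ℓ) (ζs (i + 1))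
              linarith
          _ ≤ 2 * b1 * (lM + 1) + D' + D' := by linarith [hζs (i + 1) hi1k, hζs i hik]
          _ = 2 * b1 * (lM + 1) + 2 * D' := by ring
      have e3 : s ^ 2 ≤ A ^ 2 := by
        rw [← sq_abs]; exact pow_le_pow_left₀ (abs_nonneg s) hsA 2
      rw [hBdef]; linarith
    -- `u_{i+1} = T₃(u_i) + r`
    set r : ℝ := u (i + 1) - stepPoly v₂ w M (Li (i + 1)) (u i) with hrdef
    have hr : |r| ≤ C * (u i) ^ 4 := hSEi
    have hu'eq : u (i + 1) = u i + s * (u i) ^ 2 + (t + s ^ 2) * (u i) ^ 3 + r := by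
      rw [hrdef]
      show u (i + 1) = u i + s * (u i) ^ 2 + (t + s ^ 2) * (u i) ^ 3
        + (u (i + 1) - (u i + s * (u i) ^ 2 + (t + s ^ 2) * (u i) ^ 3))
      ring
    have hsmall : (A + B + C + 1) * u i ≤ 1 / 4 := by
      have h11 : (A + B + C + 1) * u i ≤ (A + B + C + 1) * W⁻¹ :=
        mul_le_mul_of_nonneg_left huW (by positivity)
      have h12 : (A + B + C + 1) * W⁻¹ ≤ 1 / 4 := by
        rw [← div_eq_mul_inv, div_le_iff₀ hWpos]; linarith
      linarith
    obtain ⟨hlo, hhi, hdu, hinv⟩ := inv_step hui hsA htB hC0 hr hu'eq hsmall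
    have hu'pos : 0 < u (i + 1) := by linarith
    have hx' : 4 / 5 * x i ≤ x (i + 1) := by
      rw [hx_def, hx_def]
      have h13 : (5 / 4 * u i)⁻¹ ≤ (u (i + 1))⁻¹ := (inv_le_inv₀ (by positivity) hu'pos).2 hhi
      have h14 : (5 / 4 * u i)⁻¹ = 4 / 5 * (u i)⁻¹ := by rw [mul_inv]; norm_num
      linarith
    -- the `z`-flow step
    have hz4 := zflow_step (u := u i) (u' := u (i + 1)) (δ := δs i) (δ' := δs (i + 1)) (ζ := ζs i) (ζ' := ζs (i + 1))
      (lM := lM) (Lr := (Li i : ℝ)) (W := W) (A := A) (B := B) (C := C) (E := E) hui hu'pos hW1 hWD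
      (by rw [← hx_def]; exact hWi) (hδs i hik) (hδs (i + 1) hi1k) (hζs i hik) (hζs (i + 1) hi1k)
      hlMpos.le hLir hℓ1 hℓ2 hs ht (by rw [← hx_def, ← hx_def]; exact hinv) hdu (by positivity)
    have hzi : z i = (u i)⁻¹ + δs i + ζs i * u i := by rw [hz_def, hx_def]
    have hzi' : z (i + 1) = (u (i + 1))⁻¹ + δs (i + 1) + ζs (i + 1) * u (i + 1) := by rw [hz_def, hx_def]
    obtain ⟨hzpos, -, hzhi, hzf⟩ := hz4
    rw [← hzi] at hzpos hzhi hzf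
    rw [← hzi'] at hzf
    refine ⟨hu'pos, hx', ?_, ?_⟩
    · have h15 : a = 2 * b0 * lM := rfl
      rw [h15, hκa_eq]; exact hzf
    · -- `u² ≤ 4/z²` from `z ≤ (3/2) x`
      have huz : u i * z i ≤ 2 := by
        calc u i * z i ≤ u i * (3 / 2 * (u i)⁻¹) := mul_le_mul_of_nonneg_left hzhi hui.le
          _ = 3 / 2 := by field_simp
          _ ≤ 2 := by norm_num
      have huz0 : 0 ≤ u i * z i := by positivity
      rw [le_div_iff₀ (by positivity)]
      calc u i ^ 2 * z i ^ 2 = (u i * z i) ^ 2 := by ring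
        _ ≤ 2 ^ 2 := pow_le_pow_left₀ huz0 huz 2
        _ = 4 := by norm_num
  -- ### the junction on a prefix, from the weak floor
  have junction : ∀ j, j ≤ k → (∀ i, i ≤ j → W ≤ x i ∧ 0 < u i) →
      |z j - invRunningCoupling β (Li j) - (b1 / b0) * Real.log (z j / b0)| ≤ Φs := by
    intro j hj hfl
    -- floor for `y` on `[0, j+1]`
    have hzge : ∀ i, i ≤ j → x i - (D + D') ≤ z i := by
      intro i hi
      have h9 := (hzx i (hi.trans hj) (hfl i hi).1 (hfl i hi).2).1
      have := (abs_le.mp h9).1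
      linarith
    have hyfloor : ∀ i, i ≤ j + 1 → m ≤ y i := by
      intro i hi
      rcases Nat.eq_zero_or_pos i with h0 | hpos
      · subst h0; rw [hy0]; linarith
      · obtain ⟨i', rfl⟩ : ∃ i', i = i' + 1 := ⟨i - 1, by omega⟩
        rw [hysucc]
        have hi' : i' ≤ j := by omega
        have := hzge i' hi'
        have := (hfl i' hi').1
        linarith
    -- flow identity (by definition of `e`)
    have hflow : ∀ i, i < j + 1 →
        y i - y (i + 1) = 2 * b0 * Real.log M + (b1 / b0) * (2 * b0 * Real.log M) / y i + e i := by
      intro i _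
      rw [he_def]
      have h15 : a = 2 * b0 * Real.log M := rfl
      have h16 : κa = (b1 / b0) * (2 * b0 * Real.log M) := rfl
      rw [h15, h16]; ring
    -- the bare step `e 0`
    have hbase0 := hbase (Li 0) (hLi1 0 (Nat.zero_le _)) hL0lt.le β hββ₁
    have he0 : |e 0| ≤ Rinit := by
      have hx0 : |x 0 - β / 2| ≤ CB := by
        rw [hx_def, hu_def]; exact (hbase0.2).trans (le_max_left _ _)
      have hzx0 := (hzx 0 (Nat.zero_le _) (hfl 0 (Nat.zero_le _)).1 (hfl 0 (Nat.zero_le _)).2).1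
      rw [he_zero]
      have hκβ : 0 ≤ κa / (β / 2) := by positivity
      have hκβ' : κa / (β / 2) ≤ 2 * κa := by
        rw [div_le_iff₀ (by positivity)]
        have := mul_le_mul_of_nonneg_left hβ1 hκa0
        linarith
      have := abs_le.mp hx0
      have := abs_le.mp hzx0
      have h17 : Rinit = CB + D + D' + a + 2 * κa := rfl
      rw [abs_le]; constructor <;> linarith
    -- the per-step remainders
    have hstep : ∀ i, i < j → |e (i + 1)| ≤ 2 * (b0 + b1) / (Li i : ℝ) + Qc * (1 / (y (i + 1)) ^ 2) := by
      intro i hi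
      have hik : i < k := lt_of_lt_of_le hi hj
      obtain ⟨-, -, hf, hu2⟩ := stepFacts i hik (hfl i hi.le).1 (hfl i hi.le).2
      rw [he_succ, hysucc]
      have h18 : Qc = 4 * Q₁ := rfl
      calc |z i - z (i + 1) - a - κa / z i| ≤ 2 * (b0 + b1) / (Li i : ℝ) + Q₁ * (u i) ^ 2 := hf
        _ ≤ 2 * (b0 + b1) / (Li i : ℝ) + Q₁ * (4 / (z i) ^ 2) := by
            have := mul_le_mul_of_nonneg_left hu2 hQ₁0; linarith
        _ = 2 * (b0 + b1) / (Li i : ℝ) + Qc * (1 / (z i) ^ 2) := by rw [h18]; ring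
    -- geometric sum of `1/L_i`
    have hgeo : ∑ i ∈ Finset.range j, 2 * (b0 + b1) / (Li i : ℝ) ≤ 4 * (b0 + b1) / N := by
      have hterm : ∀ i ∈ Finset.range j, 2 * (b0 + b1) / (Li i : ℝ) ≤ (2 * (b0 + b1) / N) * (1 / 2) ^ i := by
        intro i hi
        have hik : i ≤ k := (Finset.mem_range.mp hi).le.trans hj
        have hLi := hLi2 i hik
        have hN2pos : (0 : ℝ) < (N : ℝ) * 2 ^ i := by positivity
        have h19 : 1 / (Li i : ℝ) ≤ 1 / ((N : ℝ) * 2 ^ i) := one_div_le_one_div_of_le hN2pos hLi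
        have h20 : (2 * (b0 + b1) / N) * (1 / 2 : ℝ) ^ i = 2 * (b0 + b1) * (1 / ((N : ℝ) * 2 ^ i)) := by
          rw [div_pow, one_pow]; field_simp
        rw [h20, div_eq_mul_one_div (2 * (b0 + b1)) (Li i : ℝ)]
        exact mul_le_mul_of_nonneg_left h19 (by positivity)
      calc ∑ i ∈ Finset.range j, 2 * (b0 + b1) / (Li i : ℝ)
          ≤ ∑ i ∈ Finset.range j, (2 * (b0 + b1) / N) * (1 / 2 : ℝ) ^ i := Finset.sum_le_sum hterm
        _ = (2 * (b0 + b1) / N) * ∑ i ∈ Finset.range j, (1 / 2 : ℝ) ^ i := by rw [Finset.mul_sum]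
        _ ≤ (2 * (b0 + b1) / N) * 2 := mul_le_mul_of_nonneg_left (sum_geometric_two_le j) (by positivity)
        _ = 4 * (b0 + b1) / N := by ring
    -- the self-referential budget
    have hbudget : ∑ i ∈ Finset.range (j + 1), |e i| ≤ P + Qc * ∑ i ∈ Finset.range (j + 1), 1 / (y i) ^ 2 := by
      rw [Finset.sum_range_succ' (fun i => |e i|), Finset.sum_range_succ' (fun i => 1 / (y i) ^ 2)]
      have hS1 : ∑ i ∈ Finset.range j, |e (i + 1)|
          ≤ ∑ i ∈ Finset.range j, (2 * (b0 + b1) / (Li i : ℝ) + Qc * (1 / (y (i + 1)) ^ 2)) :=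
        Finset.sum_le_sum fun i hi => hstep i (Finset.mem_range.mp hi)
      rw [Finset.sum_add_distrib, ← Finset.mul_sum] at hS1
      have hy0sq : 0 ≤ 1 / (y 0) ^ 2 := by positivity
      have hQy0 : 0 ≤ Qc * (1 / (y 0) ^ 2) := mul_nonneg hQc0 hy0sq
      have h21 : P = Rinit + 4 * (b0 + b1) / N := rfl
      rw [mul_add]
      linarith [hS1, hgeo, he0, hQy0]
    have hmQ : 4 * Qc ≤ m ^ 2 * a := by
      calc 4 * Qc ≤ m * a := hm3'
        _ = 1 * (m * a) := by ring
        _ ≤ m * (m * a) := mul_le_mul_of_nonneg_right hm1 (by positivity)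
        _ = m ^ 2 * a := by ring
    have hRsum := remainder_bootstrap (y := y) (e := e) (K := j + 1) hapos hκa0 hm1 hQc0 hmQ hyfloor
      (fun i _ => by rw [he_def]; ring) hbudget
    have hR : ∑ i ∈ Finset.range (j + 1), |e i| ≤ R := by
      have h11 : 2 * Qc / (m * a) ≤ 2 := by
        rw [div_le_iff₀ (by positivity)]
        have hma : 0 ≤ m * a := by positivity
        linarith [hm3', hma, hQc0]
      have h22 : R = 2 * P + 2 := rfl
      linarith [hRsum, h11]
    have hsmall : 2 * b0 * Real.log M + (b1 / b0) * (2 * b0 * Real.log M) + R ≤ m / 2 := by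
      have h15 : a = 2 * b0 * Real.log M := rfl
      have h16 : κa = (b1 / b0) * (2 * b0 * Real.log M) := rfl
      rw [← h15, ← h16]; linarith
    -- the tower condition with `b = ⌊L_0/M⌋`
    have hL0N : N ≤ Li 0 := hLiN' 0 (Nat.zero_le _)
    have hb1 : 1 ≤ Li 0 / M := (Nat.le_div_iff_mul_le hMpos).2 (by rw [one_mul]; exact le_trans hNM hL0N)
    have hbN : Li 0 / M < N := Nat.div_lt_of_lt_mul (by simpa [Nat.mul_comm] using hL0lt)
    have htower := tower_log_condition (M := M) (Lj := Li j) (L0 := Li 0) (b := Li 0 / M) (j := j) hM hb1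
      (tower_zero_of_le hj) rfl
    have hFJ := TowerFlow.flowJunction (x := y) (e := e) (β := β) (K := j + 1) (b := Li 0 / M) (L := Li j)
      hM1 hm1 hR hsmall hyfloor hy0 hflow htower
    rw [hysucc] at hFJ
    -- `Φ(b) ≤ Φs`
    have hlogb : |Real.log ((Li 0 / M : ℕ) : ℝ)| ≤ Real.log (N : ℝ) := by
      have hb1r : (1 : ℝ) ≤ ((Li 0 / M : ℕ) : ℝ) := by exact_mod_cast hb1
      have hbNr : ((Li 0 / M : ℕ) : ℝ) ≤ N := by exact_mod_cast hbN.le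
      rw [abs_of_nonneg (Real.log_nonneg hb1r)]
      exact Real.log_le_log (by linarith) hbNr
    have hmul : 2 * b0 * (|Real.log ((Li 0 / M : ℕ) : ℝ)| + 1) ≤ 2 * b0 * (Real.log (N : ℝ) + 1) :=
      mul_le_mul_of_nonneg_left (by linarith) (by positivity)
    have h23 : Φs = (b1 / b0) * (((b1 / b0) * (2 * b0 * Real.log M) + m ^ 2 / 2)
        * ((1 / m + 2 * R / m ^ 2) / (2 * b0 * Real.log M)) + R / m) + R + 2 * b0 * (Real.log (N : ℝ) + 1) := rfl
    rw [h23]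
    linarith [hFJ, hmul]
  -- ### the strong floor by induction along the tower
  have floor : ∀ j, j ≤ k → ∀ i, i ≤ j → 2 * W ≤ x i ∧ 0 < u i := by
    intro j
    induction j with
    | zero =>
      intro _ i hi
      have hi0 : i = 0 := by omega
      subst hi0
      have hbase0 := hbase (Li 0) (hLi1 0 (Nat.zero_le _)) hL0lt.le β hββ₁
      refine ⟨?_, hbase0.1⟩
      have h24 := (abs_le.mp ((hbase0.2).trans (le_max_left CB₀ 0))).1
      rw [hx_def, hu_def]
      linarith
    | succ j ih =>
      intro hjk i hi
      have hjk' : j ≤ k := Nat.le_of_succ_le hjk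
      have ih' := ih hjk'
      rcases Nat.lt_or_ge i (j + 1) with hlt | hge
      · exact ih' i (by omega)
      · have hij : i = j + 1 := by omega
        subst hij
        have hjlt : j < k := hjk
        have hWj : W ≤ x j := by linarith [(ih' j le_rfl).1]
        obtain ⟨hu'pos, hx', -, -⟩ := stepFacts j hjlt hWj (ih' j le_rfl).2
        have hweak : ∀ i, i ≤ j + 1 → W ≤ x i ∧ 0 < u i := by
          intro i hi
          rcases Nat.lt_or_ge i (j + 1) with hlt | hge
          · exact ⟨by linarith [(ih' i (by omega)).1], (ih' i (by omega)).2⟩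
          · have : i = j + 1 := by omega
            subst this
            exact ⟨by linarith [(ih' j le_rfl).1], hu'pos⟩
        have hJ := junction (j + 1) hjk hweak
        refine ⟨?_, hu'pos⟩
        -- upgrade: `z ≥ z − κ log(z/b0) ≥ invRC − Φs ≥ V − Φs ≥ X'`
        have hzx1 := hzx (j + 1) hjk (hweak (j + 1) le_rfl).1 hu'pos
        have hz1 : 1 ≤ z (j + 1) := by
          have := (abs_le.mp hzx1.1).1
          have := (hweak (j + 1) le_rfl).1
          linarith
        have hlog0 : 0 ≤ (b1 / b0) * Real.log (z (j + 1) / b0) := by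
          apply mul_nonneg hκ
          apply Real.log_nonneg
          rw [le_div_iff₀ hb0]; linarith
        have hinvj : invRunningCoupling β L ≤ invRunningCoupling β (Li (j + 1)) :=
          invRunningCoupling_antitone (hLi1 (j + 1) hjk) (hLile (j + 1) hjk)
        have := (abs_le.mp hJ).1
        have := (abs_le.mp hzx1.1).2
        have h25 : X' = 2 * W + D + D' := rfl
        linarith
  -- ### conclusion at the top of the tower
  have hweakk : ∀ i, i ≤ k → W ≤ x i ∧ 0 < u i :=
    fun i hi => ⟨by linarith [(floor k le_rfl i hi).1], (floor k le_rfl i hi).2⟩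
  have hJk := junction k le_rfl hweakk
  have hxk := (floor k le_rfl k le_rfl).1
  have huk := (floor k le_rfl k le_rfl).2
  have hzxk := (hzx k le_rfl (hweakk k le_rfl).1 huk).1
  have hxk1 : 1 ≤ x k := by linarith
  have hxkpos : 0 < x k := by linarith
  -- pass from `z_k` to `x_k`
  have hzk_lo : x k / 2 ≤ z k := by
    have := (abs_le.mp hzxk).1; linarith
  have hzk_hi : z k ≤ 3 / 2 * x k := by
    have := (abs_le.mp hzxk).2; linarith
  have hzkpos : 0 < z k := by linarith
  have hlogzx : |Real.log (z k / b0) - Real.log (x k / b0)| ≤ Real.log 2 := by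
    rw [← Real.log_div (by positivity) (by positivity)]
    have hq : z k / b0 / (x k / b0) = z k / x k := by field_simp
    rw [hq, abs_le]
    constructor
    · rw [← Real.log_inv]
      apply Real.log_le_log (by norm_num)
      rw [le_div_iff₀ hxkpos]; linarith
    · apply Real.log_le_log (by positivity)
      rw [div_le_iff₀ hxkpos]; linarith
  have hxjunction : |x k - invRunningCoupling β L - (b1 / b0) * Real.log (x k / b0)| ≤ Φss := by
    rw [hLitop] at hJk
    have hdec : x k - invRunningCoupling β L - (b1 / b0) * Real.log (x k / b0)
        = (z k - invRunningCoupling β L - (b1 / b0) * Real.log (z k / b0)) - (z k - x k)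
          + (b1 / b0) * (Real.log (z k / b0) - Real.log (x k / b0)) := by ring
    rw [hdec]
    have hκlog : |(b1 / b0) * (Real.log (z k / b0) - Real.log (x k / b0))| ≤ (b1 / b0) * Real.log 2 := by
      rw [abs_mul, abs_of_nonneg hκ]
      exact mul_le_mul_of_nonneg_left hlogzx hκ
    have h26 : Φss = Φs + (D + D') + (b1 / b0) * Real.log 2 := rfl
    calc _ ≤ |z k - invRunningCoupling β L - (b1 / b0) * Real.log (z k / b0)| + |z k - x k|
            + |(b1 / b0) * (Real.log (z k / b0) - Real.log (x k / b0))| := by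
          have := abs_sub (z k - invRunningCoupling β L - (b1 / b0) * Real.log (z k / b0)) (z k - x k)
          have := abs_add_le ((z k - invRunningCoupling β L - (b1 / b0) * Real.log (z k / b0)) - (z k - x k))
            ((b1 / b0) * (Real.log (z k / b0) - Real.log (x k / b0)))
          linarith
      _ ≤ Φs + (D + D') + (b1 / b0) * Real.log 2 := by linarith [hJk, hzxk, hκlog]
      _ = Φss := h26.symm
  have hratio := hY (x k) (invRunningCoupling β L) hxk1 (hVY.trans hVinv) hxjunction
  -- `|x/y − 1| ≤ η' ⇒ |y/x − 1| ≤ 2η' ≤ η`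
  have hGx : G β L * invRunningCoupling β L = invRunningCoupling β L / x k := by
    have h27 : u k = G β L := by rw [hu_def, hLitop]
    rw [← h27, hx_def, div_inv_eq_mul, mul_comm]
  rw [hGx]
  set τ : ℝ := x k / invRunningCoupling β L with hτdef
  have hτpos : 0 < τ := by positivity
  have hτne : τ ≠ 0 := hτpos.ne'
  have hτ : |τ - 1| ≤ η' := hratio
  have hτlo : 1 / 2 ≤ τ := by
    have := (abs_le.mp hτ).1; linarith
  have hinvτ : invRunningCoupling β L / x k = τ⁻¹ := by
    rw [hτdef, inv_div]
  rw [hinvτ]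
  have h28 : τ⁻¹ - 1 = (1 - τ) / τ := by field_simp
  rw [h28, abs_div, abs_of_pos hτpos, div_le_iff₀ hτpos]
  rw [abs_sub_comm] at hτ
  calc |1 - τ| ≤ η' := hτ
    _ = 2 * η' * (1 / 2) := by ring
    _ ≤ η * τ := mul_le_mul hη'le hτlo (by norm_num) hη.le


/-! ## §6 Complements (gen 4, rev 2): `BaseBounded ⇒ BaseTree`, and a one-loop toy clock inhabiting three of the four hypotheses -/

/-- gen-3's `BaseTree` VERBATIM (`SketchIdeator1g3 :: Ideas.PhysicalClock.BaseTree`): tree-level matching of the clock to the label at each fixed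
lattice size. [cite: LuscherMunster1984, §2] -/
def BaseTree (G : ℝ → ℕ → ℝ) : Prop :=
  ∀ (b : ℕ) [NeZero b] (η : ℝ), 0 < η → ∃ β1 : ℝ, ∀ β : ℝ, β1 ≤ β → |G β b * invRunningCoupling β b - 1| ≤ η

/-- `log β ≤ 2√β` for `β > 0`. [folklore] -/
theorem log_le_two_sqrt {β : ℝ} (hβ : 0 < β) : Real.log β ≤ 2 * Real.sqrt β := by
  have hs : 0 < Real.sqrt β := Real.sqrt_pos.mpr hβ
  have h1 : Real.log (Real.sqrt β) ≤ Real.sqrt β - 1 := Real.log_le_sub_one_of_pos hs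
  have h2 : Real.log (Real.sqrt β) = Real.log β / 2 := Real.log_sqrt hβ.le
  linarith

/-- ★ §6a `BaseBounded G → BaseTree G`: the gen-4 base hypothesis subsumes gen-3's, so the assembled line
`SBase → BaseRegular G → TowerX G → StepExpansion G v₂ w M → OneLoopLogGrowth v₂ → TwoLoopLogGrowth w → BaseBounded G → TTS` needs no separate `BaseTree`.
(`1/G = β/2 + O(1)` and `invRC = β/2 + O(log β)` at fixed `b`, times `G = O(1/β)`.) [cite: LuscherMunster1984, §2] -/
theorem baseTree_of_baseBounded {G : ℝ → ℕ → ℝ} (hB : BaseBounded G) : BaseTree G := by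
  intro b _ η hη
  have hb1 : 1 ≤ b := Nat.one_le_iff_ne_zero.mpr (NeZero.ne b)
  have hb0 : 0 < b0 := by unfold b0; positivity
  have hb1' : 0 < b1 := by unfold b1; positivity
  have hκ : 0 ≤ b1 / b0 := (div_pos hb1' hb0).le
  obtain ⟨C₀, β₁, hbase⟩ := hB b
  set C : ℝ := max C₀ 0 with hCdef
  have hC0 : 0 ≤ C := le_max_right _ _
  have hbr : (1 : ℝ) ≤ b := by exact_mod_cast hb1
  have hlogb : 0 ≤ Real.log (b : ℝ) := Real.log_nonneg hbr
  set κ : ℝ := b1 / b0 with hκdef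
  set A : ℝ := 2 * b0 * Real.log (b : ℝ) + κ * |Real.log (2 * b0)| + C with hAdef
  have hA0 : 0 ≤ A := by positivity
  set βs : ℝ := max (max β₁ (4 * C + 4)) (max (8 * A / η + 1) ((16 * κ / η) ^ 2 + 1)) with hβsdef
  refine ⟨βs, fun β hβ => ?_⟩
  have hβ₁ : β₁ ≤ β := le_trans (le_trans (le_max_left _ _) (le_max_left _ _)) hβ
  have hβC : 4 * C + 4 ≤ β := le_trans (le_trans (le_max_right _ _) (le_max_left _ _)) hβ
  have hβA : 8 * A / η + 1 ≤ β := le_trans (le_trans (le_max_left _ _) (le_max_right _ _)) hβ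
  have hβκ : (16 * κ / η) ^ 2 + 1 ≤ β := le_trans (le_trans (le_max_right _ _) (le_max_right _ _)) hβ
  have hβpos : 0 < β := by linarith
  have hβ1 : 1 ≤ β := by linarith
  obtain ⟨hGpos, hGC₀⟩ := hbase b hb1 le_rfl β hβ₁
  have hGC : |(G β b)⁻¹ - β / 2| ≤ C := hGC₀.trans (le_max_left _ _)
  -- `G ≤ 4/β`
  have hGinv : β / 4 ≤ (G β b)⁻¹ := by
    have := (abs_le.mp hGC).1; linarith
  have hG4 : G β b ≤ 4 / β := by
    have h := (inv_le_inv₀ (inv_pos.mpr hGpos) (by positivity : (0:ℝ) < β / 4)).2 hGinv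
    rw [inv_inv] at h
    calc G β b ≤ (β / 4)⁻¹ := h
      _ = 4 / β := by rw [inv_div]
  -- `|invRC − 1/G| ≤ A + κ log β`
  have hlog2b0β : |Real.log (2 * b0 / β)| ≤ |Real.log (2 * b0)| + Real.log β := by
    rw [Real.log_div (by positivity) hβpos.ne']
    calc |Real.log (2 * b0) - Real.log β| ≤ |Real.log (2 * b0)| + |Real.log β| := abs_sub _ _
      _ = |Real.log (2 * b0)| + Real.log β := by rw [abs_of_nonneg (Real.log_nonneg hβ1)]
  have hinv : |invRunningCoupling β b - (G β b)⁻¹| ≤ A + κ * Real.log β := by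
    rw [BOHandover.invRunningCoupling_eq]
    have e1 : |(-(2 * b0 * Real.log (b : ℝ)))| = 2 * b0 * Real.log (b : ℝ) := by
      rw [abs_neg, abs_of_nonneg (by positivity)]
    have e2 : |(b1 / b0) * Real.log (2 * b0 / β)| ≤ κ * (|Real.log (2 * b0)| + Real.log β) := by
      rw [abs_mul, abs_of_nonneg hκ]
      exact mul_le_mul_of_nonneg_left hlog2b0β hκ
    have e3 : |β / 2 - (G β b)⁻¹| ≤ C := by rw [abs_sub_comm]; exact hGC
    have hdec : β / 2 - 2 * b0 * Real.log (b : ℝ) + (b1 / b0) * Real.log (2 * b0 / β) - (G β b)⁻¹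
        = (-(2 * b0 * Real.log (b : ℝ))) + (b1 / b0) * Real.log (2 * b0 / β) + (β / 2 - (G β b)⁻¹) := by ring
    rw [hdec]
    have t1 := abs_add_le ((-(2 * b0 * Real.log (b : ℝ))) + (b1 / b0) * Real.log (2 * b0 / β)) (β / 2 - (G β b)⁻¹)
    have t2 := abs_add_le (-(2 * b0 * Real.log (b : ℝ))) ((b1 / b0) * Real.log (2 * b0 / β))
    have hAeq : A = 2 * b0 * Real.log (b : ℝ) + κ * |Real.log (2 * b0)| + C := rfl
    rw [hAeq]
    linarith
  -- assemble: `|G·invRC − 1| = G·|invRC − 1/G| ≤ (4/β)(A + κ log β) ≤ η`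
  have hprod : G β b * invRunningCoupling β b - 1 = G β b * (invRunningCoupling β b - (G β b)⁻¹) := by
    rw [mul_sub, mul_inv_cancel₀ hGpos.ne']
  rw [hprod, abs_mul, abs_of_pos hGpos]
  have hlogβ : Real.log β ≤ 2 * Real.sqrt β := log_le_two_sqrt hβpos
  have hsqrtpos : 0 < Real.sqrt β := Real.sqrt_pos.mpr hβpos
  have hsq : Real.sqrt β ^ 2 = β := Real.sq_sqrt hβpos.le
  have hκη : 0 ≤ 16 * κ / η := by positivity
  have hsqrtκ : 16 * κ / η ≤ Real.sqrt β := by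
    have h1 : (16 * κ / η) ^ 2 ≤ β := by linarith
    calc 16 * κ / η = Real.sqrt ((16 * κ / η) ^ 2) := (Real.sqrt_sq hκη).symm
      _ ≤ Real.sqrt β := Real.sqrt_le_sqrt h1
  have hterm1 : G β b * A ≤ η / 2 := by
    have h8 : 8 * A ≤ η * β := by
      have : 8 * A / η ≤ β := by linarith
      have := (div_le_iff₀ hη).1 this
      linarith
    calc G β b * A ≤ 4 / β * A := mul_le_mul_of_nonneg_right hG4 hA0
      _ = 4 * A / β := by ring
      _ ≤ η / 2 := by rw [div_le_iff₀ hβpos]; linarith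
  have hterm2 : G β b * (κ * Real.log β) ≤ η / 2 := by
    have hGκ : 0 ≤ G β b * κ := by positivity
    have h16 : 16 * κ ≤ η * Real.sqrt β := by
      have := mul_le_mul_of_nonneg_left hsqrtκ hη.le
      calc 16 * κ = η * (16 * κ / η) := by field_simp
        _ ≤ η * Real.sqrt β := this
    calc G β b * (κ * Real.log β) = (G β b * κ) * Real.log β := by ring
      _ ≤ (G β b * κ) * (2 * Real.sqrt β) := mul_le_mul_of_nonneg_left hlogβ hGκ
      _ ≤ (4 / β * κ) * (2 * Real.sqrt β) := by
          apply mul_le_mul_of_nonneg_right _ (by positivity)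
          exact mul_le_mul_of_nonneg_right hG4 hκ
      _ = 8 * κ * Real.sqrt β / β := by ring
      _ ≤ η / 2 := by
          rw [div_le_iff₀ hβpos]
          -- `8κ√β ≤ (η/2) β = (η/2) √β·√β`, from `16κ ≤ η√β`
          have : 8 * κ * Real.sqrt β ≤ (η * Real.sqrt β) / 2 * Real.sqrt β := by
            have := mul_le_mul_of_nonneg_right h16 hsqrtpos.le
            linarith
          calc 8 * κ * Real.sqrt β ≤ (η * Real.sqrt β) / 2 * Real.sqrt β := this
            _ = η / 2 * Real.sqrt β ^ 2 := by ring
            _ = η / 2 * β := by rw [hsq]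
  calc G β b * |invRunningCoupling β b - (G β b)⁻¹| ≤ G β b * (A + κ * Real.log β) :=
        mul_le_mul_of_nonneg_left hinv hGpos.le
    _ = G β b * A + G β b * (κ * Real.log β) := by ring
    _ ≤ η / 2 + η / 2 := add_le_add hterm1 hterm2
    _ = η := by ring

/-- The ONE-LOOP toy clock `G₁(β,L) := (β/2 − 2b₀ log L)⁻¹` (exact one-loop running, `v₂ = 2b₀ log`, `w = 0`). [cite: LuscherWeiszWolff1991, §2] -/
def oneLoopClock (β : ℝ) (L : ℕ) : ℝ := (β / 2 - 2 * b0 * Real.log (L : ℝ))⁻¹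

/-- Its formal one-loop coefficient `v₂ = 2b₀ log L`. [cite: LuscherWeiszWolff1991, §2] -/
def oneLoopCoeff (L : ℕ) : ℝ := 2 * b0 * Real.log (L : ℝ)

/-- §6b(i) `OneLoopLogGrowth` holds for the toy (with `D = 0`). [folklore] -/
theorem oneLoopLogGrowth_toy : OneLoopLogGrowth oneLoopCoeff :=
  ⟨0, fun L _ => by simp [oneLoopCoeff]⟩

/-- §6b(ii) `BaseBounded` holds for the toy (`1/G₁ − β/2 = −2b₀ log b` exactly). [folklore] -/
theorem baseBounded_toy : BaseBounded oneLoopClock := by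
  intro N
  have hb0 : 0 < b0 := by unfold b0; positivity
  refine ⟨2 * b0 * Real.log ((N : ℝ) + 1), 4 * b0 * Real.log ((N : ℝ) + 1) + 2, fun b hb hbN β hβ => ?_⟩
  have hbr : (1 : ℝ) ≤ b := by exact_mod_cast hb
  have hbN' : (b : ℝ) ≤ (N : ℝ) + 1 := by
    have : (b : ℝ) ≤ N := by exact_mod_cast hbN
    linarith
  have hlogb : 0 ≤ Real.log (b : ℝ) := Real.log_nonneg hbr
  have hlogbN : Real.log (b : ℝ) ≤ Real.log ((N : ℝ) + 1) := Real.log_le_log (by linarith) hbN'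
  have hmul : 2 * b0 * Real.log (b : ℝ) ≤ 2 * b0 * Real.log ((N : ℝ) + 1) := mul_le_mul_of_nonneg_left hlogbN (by positivity)
  have hden : 0 < β / 2 - 2 * b0 * Real.log (b : ℝ) := by linarith
  refine ⟨inv_pos.mpr hden, ?_⟩
  unfold oneLoopClock
  rw [inv_inv]
  have : β / 2 - 2 * b0 * Real.log (b : ℝ) - β / 2 = -(2 * b0 * Real.log (b : ℝ)) := by ring
  rw [this, abs_neg, abs_of_nonneg (by positivity)]
  exact hmul

/-- §6b(iii) `StepExpansion` holds for the toy with ITS OWN coefficients (`v₂ = 2b₀ log`, `w = 0`): `G₁(L) = g/(1 − sg)`, `g = G₁(L/M)`,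
`s = 2b₀ log(L/(L/M))`, so `G₁(L) − T₃(g) = s³g⁴/(1 − sg)`, and `s ≤ 2b₀(log M + 1)`. [cite: LuscherWeiszWolff1991, §2] -/
theorem stepExpansion_toy {M : ℕ} (hM : 2 ≤ M) : StepExpansion oneLoopClock oneLoopCoeff (fun _ => 0) M := by
  have hb0 : 0 < b0 := by unfold b0; positivity
  have hMpos : 0 < M := by omega
  have hM1 : (1 : ℝ) ≤ (M : ℝ) := by exact_mod_cast hMpos
  set S : ℝ := 2 * b0 * (Real.log (M : ℝ) + 1) with hSdef
  have hlogM : 0 ≤ Real.log (M : ℝ) := Real.log_nonneg hM1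
  have hS0 : 0 < S := by positivity
  refine ⟨1 / (2 * S), by positivity, 2 * S ^ 3, M, fun L hL β hg hgu => ?_⟩
  set g : ℝ := oneLoopClock β (L / M) with hgdef
  have hLM1 : 1 ≤ L / M := (Nat.le_div_iff_mul_le hMpos).2 (by simpa using hL)
  have hlog := log_step_bounds (M := M) (L' := L) (L'' := L / M) hMpos hLM1 rfl
  set s : ℝ := stepOne oneLoopCoeff M L with hsdef
  have hs_eq : s = 2 * b0 * (Real.log (L : ℝ) - Real.log ((L / M : ℕ) : ℝ)) := by
    show 2 * b0 * Real.log (L : ℝ) - 2 * b0 * Real.log ((L / M : ℕ) : ℝ) = _; ring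
  have hs0 : 0 ≤ s := by
    rw [hs_eq]; exact mul_nonneg (by positivity) (by linarith [hlog.1])
  have hsS : s ≤ S := by
    rw [hs_eq, hSdef]
    have hLM1r : (1 : ℝ) ≤ ((L / M : ℕ) : ℝ) := by exact_mod_cast hLM1
    have : 1 / ((L / M : ℕ) : ℝ) ≤ 1 := by rw [div_le_one (by linarith)]; exact hLM1r
    exact mul_le_mul_of_nonneg_left (by linarith [hlog.2]) (by positivity)
  have hsg : s * g ≤ 1 / 2 := by
    calc s * g ≤ S * (1 / (2 * S)) := mul_le_mul hsS hgu hg.le hS0.le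
      _ = 1 / 2 := by field_simp
  have h1sg : 1 / 2 ≤ 1 - s * g := by linarith
  have h1sgpos : 0 < 1 - s * g := by linarith
  have hginv : g⁻¹ = β / 2 - 2 * b0 * Real.log ((L / M : ℕ) : ℝ) := by
    rw [hgdef]; unfold oneLoopClock; rw [inv_inv]
  have hgne : g ≠ 0 := hg.ne'
  have hGL : oneLoopClock β L = g / (1 - s * g) := by
    unfold oneLoopClock
    have hden : β / 2 - 2 * b0 * Real.log (L : ℝ) = g⁻¹ - s := by rw [hginv, hs_eq]; ring
    rw [hden]
    have : g⁻¹ - s = (1 - s * g) / g := by field_simp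
    rw [this, inv_div]
  have hT : stepPoly oneLoopCoeff (fun _ => 0) M L g = g + s * g ^ 2 + s ^ 2 * g ^ 3 := by
    simp only [stepPoly, stepTwo, ← hsdef]; ring
  rw [hGL, hT]
  have hne : 1 - s * g ≠ 0 := h1sgpos.ne'
  have hdiff : g / (1 - s * g) - (g + s * g ^ 2 + s ^ 2 * g ^ 3) = s ^ 3 * g ^ 4 / (1 - s * g) := by
    rw [eq_div_iff hne, sub_mul, div_mul_cancel₀ g hne]
    ring
  rw [hdiff, abs_of_nonneg (by positivity)]
  calc s ^ 3 * g ^ 4 / (1 - s * g) ≤ s ^ 3 * g ^ 4 / (1 / 2) :=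
        div_le_div_of_nonneg_left (by positivity) (by norm_num) h1sg
    _ = 2 * s ^ 3 * g ^ 4 := by ring
    _ ≤ 2 * S ^ 3 * g ^ 4 := by
        have h3 : s ^ 3 ≤ S ^ 3 := pow_le_pow_left₀ hs0 hsS 3
        have hg4 : 0 ≤ g ^ 4 := by positivity
        have := mul_le_mul_of_nonneg_right h3 hg4
        linarith

/-- §6b(iv) … but `TwoLoopLogGrowth` FAILS for the toy's `w = 0` — the theorem does NOT calibrate the one-loop clock, as it must not
(Disproof §F `crux_refutes_oneLoopClock`): the two-loop growth hypothesis is the load-bearing, §F-sensitive one. [folklore] -/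
theorem not_twoLoopLogGrowth_zero : ¬ TwoLoopLogGrowth (fun _ => 0) := by
  rintro ⟨D, hD⟩
  have hb1 : 0 < b1 := by unfold b1; positivity
  obtain ⟨L, hL⟩ := exists_nat_gt (Real.exp ((|D| + 1) / (2 * b1)))
  have hexp : 0 < Real.exp ((|D| + 1) / (2 * b1)) := Real.exp_pos _
  have hLpos : (0 : ℝ) < L := hexp.trans hL
  have hLnat : 0 < L := by exact_mod_cast hLpos
  have hL1 : 1 ≤ L := hLnat
  have hlog : (|D| + 1) / (2 * b1) < Real.log (L : ℝ) := by
    rw [Real.lt_log_iff_exp_lt hLpos]; exact hL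
  have h := hD L hL1
  rw [zero_sub, abs_neg, abs_of_nonneg (by positivity)] at h
  have : |D| + 1 < 2 * b1 * Real.log (L : ℝ) := by
    rw [div_lt_iff₀ (by positivity)] at hlog; linarith
  linarith [le_abs_self D]

end Summit.QuantumFields.YangMills.Cruxes.TwistedTraceScaling.Ideas.FormalTelescoping

end
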